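import Mathlib
import Literature.MathematicalPhysics.QuantumFieldTheory.Balaban1983to89.B12
import Literature.MathematicalPhysics.QuantumFieldTheory.Balaban1983to89.Step

/-!
# `Balaban1983to89.B16` — T. Bałaban, *Large field renormalization. II. Localization, exponentiation, and bounds
for the 𝐑 operation*, Commun. Math. Phys. **122**, 355–392 (1989), doi:10.1007/bf01238433 — the END STATEMENT of the
1983–89 lattice Yang–Mills series, typed at statement level (revision v13: ADDITIVE — the print-scoped floor variant
`ineq1100_of_199_adm` of §1c (floor OR vanishing term, p. 390's "admissible domains"; cell GAPS C-b01g19-1 O4 adopted,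
C-b02g14-4) with `ineq1100_of_199_floor_of_adm` and the scope lemma `ineq1100_floor_unsat_of_small`, plus one SCOPE
sentence in the v12 docstring; no existing declaration changed; revision v12: ADDITIVE — one bookkeeping theorem
`ineq1100_of_199_floor` in §1c ((1.99) ⇒ (1.100) exactly as printed, the O(1) absorbed under an explicit tree-size floor
on the second group; cell DIVERGENCE D-b02.7, GAPS C-b02g14-2) — plus docstring notes at `ineq173` (the σ-bound: its
printed derivation covers the quadratic-form half σ_Q; the V(X~) half is the cell's OPEN objection G-adv3-21) and at
`Ineq1100`, and status pointers in the `## Section 1` docstring to the sibling modules `B16Exp198` ((1.97) ⇒ (1.98)–(1.99))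
and `B16Ineq197` ((1.92)–(1.96) ⇒ (1.97)), both downstream of this module; no existing declaration changed — none since
revision v8 apart from this one addition; revision v11: docstring-only status update, cell GAPS C-r2.35 — the leaf family
of the sibling `B16SmallCouplings` instantiated for G = SU(N) in the sibling `B16LeafFamily`).  (Cell numbering: B16; its refs [I] = [Balaban1987RG1]
(B12), [II] = [Balaban1988RG2Cluster] (B13), [III] = [Balaban1988Convergent] (B14), [IV] = [Balaban1989LargeFieldI]
(B15), [16] = [Balaban1985UV3] (B10), [15] = [Balaban1985Variational] (B11).)  PDF held:
`paper:balaban1989-cmp122-large-field-ii` (journal page = PDF page + 354).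

CITATION HEADER (lean-in-tree rule 2026-08-18).  This module is a TYPED SKELETON (statement level) of the published
paper [Balaban1989LargeFieldII] (cell paper B16) together with the two printed statements of other papers that its
end statement refers to.  WHAT IS REPRODUCED: Theorem 1 (p. 355) and the ultraviolet-stability bound (0.1)
(pp. 355–356) VERBATIM; Corollary 3 (2.50) of [Balaban1988Convergent] (p. 264) VERBATIM, with ITS dependence clause
("independent of η and T, but depending on g_k") typed separately from (0.1)'s ("independent of k, T_η, U_k") and the
two related exactly by the bookkeeping theorem `uv01_of_cor3`; the END STATEMENT (B) of the series in its printed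
CONDITIONAL form `EndStatementBPrinted = Thm1Printed ∧ Cor3_250` (revision v5, cell GAPS G-pv24-1 / C-r2.23: the pair
p. 391 declares proved — *"This completes the proof of Theorem 1 and Corollary 3."*), the earlier pin
`EndStatementB = Thm1Printed ∧ UVBound01` being KEPT on file as the recorded STRONGER reading (E± chosen before the run,
hence uniform in the coupling — a uniformity (0.1)'s clause does not list, and one that FAILS for E₊ UNDER THE CELL'S TYPED
NORMALISATION COUNT of ρ₀: sibling module `B16B10Shape`, `not_uvBound01_of_smallCouplings`, whose hypotheses are
`LogNormalised` — derived (`unitConfigLog_of_leaves`) from located leaves of which `EflBound` is that module's one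
remaining READER'S ITEM (author question (ii) of cell GAPS G-pv24-1, put to the author, OPEN), the reader's item `ZLower`
being PROVED for G = U(N) and G = SU(N) in the sibling module `B16ZLower` (`zLower_of_unitaryGroup`,
`zLower_of_specialUnitaryGroup`; noted at revision v7) and the reader's bond count `TstarCount` being PROVED, in DICTIONARY
form (the carrier's `N j`, `N (j+1)`, `Tstar j` identified with the site count, the coarse-site count and the bond count
|Ω₁*| of (1.15) [III] p. 249 for the 4-dimensional periodic lattice, every block offset), in the sibling module
`B16TstarCount` (`tstarCount_of_blockedLattices`, `tstarCount_of_torus`; unit b2b-balaban-pv24-g3, cell GAPS C-pv24g3-1,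
XREAD C-pv06-20; noted at revision v9, cell GAPS C-r2.28) — so that the non-printed inputs of the count are `EflBound` and
the identification of the abstract carrier `B16B10Shape.CountertermData` with the series' objects (the latter CARRIED OUT
IN THE KERNEL for G = SU(N) in the sibling module `B16LeafFamily`, revision v11 — see below in this docstring) — and
`SmallCouplingsOccur`; a conditional kernel result about the
cell's reading, NOT a printed statement (revision v6, cell GAPS G-ref2-11 (a); revision v10, cell GAPS
C-pv24g4-1 / C-r2.33: that PAIR of hypotheses AS TYPED is MIS-CUT AT K = 0 — both quantify over all run parameters
incl. the zero-step runs K = 0, where `SmallCouplingsOccur` is witnessed trivially and `LogNormalised` (with a positive slope c) is UNSATISFIABLE on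
forward-generated constructions with non-empty lattices and sub-unit zero-step densities (sibling module
`B16SmallCouplings` §2: `smallCouplingsOccur_of_zeroStep`, `not_logNormalised_of_zeroStep`, `logNormalised_family_unsatisfiable`;
the sub-unit density is a hypothesis there, never asserted), so the v6 caveat is a correct implication that is empty on such
constructions; the REPAIRED exact form is that sibling's `B16SmallCouplings.not_uvBound01_of_betaUpper` — ONE K-indexed
reader's hypothesis `LogNormalisedFrom` from some K₀ on (the binder `∃ K₀` is unrestricted; its content lies at K₀ ≥ 1,
`LogNormalisedFrom … 0` being `LogNormalised` by `logNormalisedFrom_zero_iff`; revision v11, XREAD C-pv12g8-1 A1) instead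
of two, the small bare couplings of runs of any prescribed length
being DISCHARGED from forward generation (`DagBinding.ForwardGenerated`, [I] (0.17)–(0.20)) + the printed UPPER β-bound
([I] p. 264 *"uniformly bounded on this interval"*, `FlowStep.BetaUpperH`) + non-empty lattices
(`smallCouplingsOccurFrom_of_betaUpper`) —, with the one-γ form `not_uvBound01_of_betaUpper_at`, the every-input-located
form `not_uvBound01_of_leaves` (K₀ = 1 logarithm from the located leaves, `logNormalisedFrom_one_of_leaves`, whose cut is the
`1 ≤ S.K` of `B16B10Shape.unitConfigLog_of_leaves`) and the `World` twin `not_forall_uvStability4D_leaves_of_betaUpper`; the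
remaining non-printed inputs are `EflBound`, the carrier identification and the cell's modelling clauses, and the printed
but unproved input is the upper β-bound; that sibling (unit b2b-balaban-pv24-g4, v1.1, XREAD C-b02g9-4 / C-pv15g4-5) imports
`FlowStepRuns`, downstream of this module, so nothing of it is importable here and no declaration below changes;
revision v11, cell GAPS C-pv24g5-1 / C-r2.35: the abstract leaf family `S P : B16B10Shape.CountertermData` of
`not_uvBound01_of_leaves` is INSTANTIATED from the series' own data in the further sibling module `B16LeafFamily` (unit
b2b-balaban-pv24-g5, v1; XREAD C-pv22g6-9; it imports `B16SmallCouplings`, so it is equally not importable here): for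
G = SU(N), N ≥ 2 (d(𝔤) = N² − 1), block size L ≥ 2 and ε₀ > 0 the carrier is BUILT from the lattice numbers of (0.1) [I]
p. 251 (ε = L^{−K}, *"We take L_μ = L^m"*, hence |T₁^{(j)}| = (2L^{m+K−j})⁴), the first-exponential constants of (1.15)
[III] p. 249 verbatim (*"+ log g₀ d(𝐠)|Ω₁*| + log σ₀|Ω₁*| − log z(L⁴ − 1)|Ω₁^{(1)}|"*) plus E^{(j+1)}(T^{(j+1)}, g_j, 1)
(p. 254) and E = their sum over the scales (p. 262 *"defined in fact as a sum of all such expressions for all the lattices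
T^{(k)} as the small field regions"*), `TstarCount` being supplied by `B16TstarCount.tstarCount_of_torus` and `ZLower` by
`B16ZLower.zLower_of_specialUnitaryGroup`, and EVERY schematic bookkeeping hypothesis about the family (fifteen, plus the
non-emptiness of the lattices) is DISCHARGED by definitions — headline `B16LeafFamily.not_uvBound01_of_torusLeaves` ⊢
¬`UVBound01 C` with ten binders, non-vacuous (`toyTorus_headline_hypotheses`); so the carrier identification named above
is discharged there, and what then stands between the kernel and ¬`UVBound01` for the series is EXACTLY (1) forward
generation `DagBinding.ForwardGenerated` ([I] (0.17)–(0.20); a modelling clause of the cell) with the printed upper β-bound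
`FlowStep.BetaUpperH` ([I] p. 264), (2) the lattice-size clause `numSites 0 = (2L^{m+K})⁴` on the abstract `Construction`
((0.1) [I]; for a construction on the cell's `Setup` carrier a one-line identification, cell DIVERGENCE F2), (3) the
NORMALISATION LEAF of [III] Thm 1 p. 262 — on the runs of one ]0, γ₁]-family (γ₁ ≤ 1) with K ≥ 1 some step-0
configuration has ρ₀ ≥ exp(−E), E the explicit printed sum (for the printed ρ₀ = exp[−(1/g₀²)A − E] this is the unit
configuration, A(1) = 0 by (0.2) [I] p. 252, *"tr 1 = 1"*); a located leaf, never asserted — and (4) the OPEN reader's item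
`EflBound`, E^{(j+1)}(T^{(j+1)}, g_j, 1) ≤ C_E·|T₁^{(j+1)}| (author question (ii) of cell GAPS G-pv24-1 / G-pv24-1a: [I]
(2.13)–(2.14) p. 268 is a normalised Gaussian expectation and no printed statement bounds it); author question (i) (the
intended K-linear rate c = 3(1 − L⁻⁴)d(𝔤)) stands; U(N) would go the same way with `B16ZLower.zLower_of_unitaryGroup` and
d(𝔤) = N²; nothing about Bałaban's densities is decided by that module, and no declaration below changes); the compact-window reading of (0.1) is
`B16B10Shape.UVBound01Compact`; its PER-RUN reading `UVBound01PerRun` ("independent of k, U_k" inside one run, where T_η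
is fixed) is a theorem of the pin (revision v6, cell GAPS G-ref2-11 (c)); its BARE-COUPLING reading `UVBound01PerBare`
(E± depending on the bare coupling only, serving all runs from it — the weakest reading that keeps "independent of T_η"
non-vacuous) follows from the compact-window statement under the flow inequality (2.6) of [Balaban1988Convergent]
— printed there (p. 255) but itself UNPROVED IN PRINT: the cell's located step (i) (p. 255 *"The inequalities follow from
the renormalization group equations (0.20) [I], and from the properties of the β-functions."*; hypothesis `B14FlowStep` /
`B14.FlowIneq26`, cell `MISSING-B14.md`), so `UVBound01PerBare` is CONDITIONAL on the interval hypothesis AND on (2.6) — and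
is NOT DERIVABLE from the pin: kernel counter-models in the sibling module `B16PerBareCounter` (`pin_not_implies_perBare`,
`compact_not_implies_perBare`, `pin_floor_not_implies_perBare`) (revision v7, cell GAPS G-ref2-16 (a); status of (2.6) and
counter-models: revision v8, cell REFEREE R27.1 (iii)–(iv) / GAPS G-ref2-19 (c); revision v9: that module's v2 §4 —
`pin_floor_not_implies_perBare_sharp` for EVERY floor parameter β₀ > 0, `perRun_of_compact`, `perBare_not_implies_compact`,
`compact_perBare_floor_not_implies_uvBound01`, `perRun_not_implies_cor3` — separates the four typed readings of the clause
PAIRWISE on toy carriers, and the by-name bridge compact window + (2.6)-floor ⇒ `UVBound01PerBare` is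
`B16B10Shape.uvPerBare_of_uvCompact_floor`; neither sibling is importable here, cell FINAL-STATEMENT §6/§6c v10–v11));
and the exact place where the unproved Theorem 2 of [Balaban1987RG1] would enter (`Thm2Shape` = `…B12.Thm2Printed` by projection; `sect2_unconditional_of_Thm2`,
`uv_unconditional_of_Thm2`).  NOTHING of the series is asserted: Theorem 1 is a published theorem whose proof is the
whole series (CMP 95, 96, 98, 99, 102, 109, 116, 119, 122) and is a CLAIM UNDER ADJUDICATION by the audit cell
`pub-balaban`; [I] Thm 2 is an announced result without published proof (p. 355 here, 1989, verbatim: *"Theorem 2 of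
[I] allows us to remove the assumption on the effective coupling constants in the above theorem, because this
assumption follows from the basic inequality (0.31) [II], which is the result of Theorem 2. The proof of Theorem 2,
which is based on second order perturbative calculations, is very awkward and long in the context of the
renormalization group approach to lattice gauge field theories, and has not been published yet, so we have Theorem 1
with the assumption."* — "(0.31) [II]" sic: (0.31) is in [I], cell DIVERGENCE D1; quotation re-read against the p. 355
render, cell GAPS C-pv13-1 (b)).  Every `def … : Prop` is a quoted leaf (journal page
[PDF page]); the only `theorem`s are quantifier bookkeeping between the printed readings (no analytic content).
Vocabulary: the carrier `RunData` EXTENDS `…B12.RunData` (run parameters `B12.RunParams`; couplings = `flow : Setup.Flow`;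
the interval hypothesis = `Setup.Flow.InInterval`) by the densities ρ_k, the characteristic functions χ_k and the
abstract predicate "ρ_k has the form described in Sect. 2 [III]"; `|T_η| = Σ_{x∈T_η} η^d` equals the number of
unit-lattice sites `numSites k` (T_η is T_1^{(k)} refined by L^k, η = L^{-k}), so volumes are `(numSites k : ℝ)` and
their sign is automatic.  Deliberately NOT here: the clause-by-clause content of "Sect. 2 [III]" ((2.1)–(2.49) of
[Balaban1988Convergent]; the cell's `Step` module), lattice gauge fields themselves (`Setup`), and any statement about
observables, continuum or infinite-volume limits — none is asserted in the series; p. 356 lists them as future work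
(quoted at the end).  §1 of the paper — its only section, (1.1)–(1.104): localization, exponentiation, the inductive proof incl. the
proof of [IV] Prop. 1 on pp. 358–359 — is the phase-2 reading of the cell (row P16, seat b2b-balaban-b02: transcript
`HOME/b2b-balaban-b02/B16-transcript.md`, GAPS.md G-B16-01…12 / C-B16-1…10 answering G-r2.4/4b, G-r2.7/8, G-adv3-4,
G-pv06-1 (Q3), G-B15-02/03, G-pv13-3); its typed part is the block `## Section 1 of the paper` below (kernels, quoted
leaves (1.68)–(1.100), `thm1_of_steps`; every passage marked verbatim there was re-read against the page renders
`HOME/b2b-balaban-ref1/pages/1989-cmp122-large-field-II/` p022/p023/p035/p036/p037 — cell GAPS G-pv13-3).  The paper's closing "another possible representation" (1.103)–(1.104) (pp. 391–392) is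
neither typed nor relied on anywhere in this module: cell GAPS G-B16-11 (adjudication upholding G-adv3-4) finds its
exponentiation NOT established in print (see the `## Section 1` docstring, item (e)); Theorem 1's printed proof closes
before that remark (p. 391 ll. 1–2).
Staged byte-identically in the cell package `run/shared/lean/pub/pub-balaban/lean/BalabanYm4/Literature/…/B16.lean`
(legacy Mathlib-only copy `BalabanYm4/B16.lean` there, namespace `BalabanYm4.B16`; tree-shape pilot
`b2b-balaban-r2/tree-staging/LargeFieldII.lean`).  Unit `b2b-balaban-r2` (reader group B+C); companion prose
`HOME/b2b-balaban-r2/B16.md`, `HOME/FINAL-STATEMENT.md` (the pinned end statement, §§1–8; §6d = the G-pv24-1 ruling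
behind revision v5); quantifier-order decision for [I] Thm 2: cell DIVERGENCE.md D-r2.3.
-/

namespace Literature.MathematicalPhysics.QuantumFieldTheory.Balaban1983to89.B16

open Literature.MathematicalPhysics.QuantumFieldTheory.Balaban1983to89

/-! ## Statement-level carrier -/

/-- What the construction delivers for one run, at statement level: the data of `B12.RunData` (flow, configurations
`Cfg k` = `V_k` on `T_1^{(k)}`, `wilsonBG k V` = `A(U_k(V_k))` with `A = A^η = Σ_p η^{d−4}[1 − Re tr U(∂p)]`,
`numSites k` = |T_1^{(k)}| = |T_η|, …) EXTENDED by: `ρ k` = the k-th effective density `ρ_k = (𝐑T)^k ρ₀`,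
`ρ₀ = exp[−(1/g₀²)A − E]` ([III] Thm 1 p. 262); `χ k` = the characteristic function `χ_k = χ_k(T_η)` of (2.17) [III]
(values in {0,1}); `Sect2Form k` = "ρ_k has the form (2.18) [III] and satisfies all the conditions and bounds
described in Sect. 2 [III]" ([III] pp. 254–264: (2.1)–(2.42), incl. Thm 2 (2.43)–(2.49)) — left ABSTRACT here. [cite: Balaban1989LargeFieldII, Thm 1 + (0.1) pp.355–356] -/
structure RunData extends B12.RunData where
  ρ : (k : ℕ) → Cfg k → ℝ
  χ : (k : ℕ) → Cfg k → ℝ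
  Sect2Form : ℕ → Prop

/-- The whole series read as a map: run parameters (`B12.RunParams`: K with ε = L^{-K}, torus exponent m, bare
coupling g₀) ↦ data; d = 4, the group, L and every construction constant are fixed inside it.  "There exist
constants … such that" ([III] Thm 1) is the choice of one `Construction`; γ is chosen after it ("The constant γ
depends on all other constants", [I] Thm 3 p. 264). [cite: Balaban1988Convergent, Thm 1 p.262] -/
def Construction : Type 1 := B12.RunParams → RunData

/-- The small-field part of a construction (forgetting ρ, χ, Sect2Form): a `B12.Construction`. [folklore] -/
def Construction.toB12 (C : Construction) : B12.Construction := fun P => (C P).toRunData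

/-- Sign convention implicit in print and needed for the bookkeeping below: `χ_k ≥ 0` (a characteristic function).
(`|T_η| ≥ 0` is automatic: a natural number.) [folklore] -/
def SignConventions (C : Construction) : Prop :=
  ∀ P : B12.RunParams, ∀ k, ∀ V, 0 ≤ (C P).χ k V

/-! ## Theorem 1 (p. 355 [1]) -/

/-- **Theorem 1**, verbatim (p. 355 [1]): *"If the sequence of the effective coupling constants is contained in an
interval ]0, γ] with a sufficiently small positive γ, then the effective densities ρ_k have the form, and satisfy all
the conditions and bounds, described in Sect. 2 [III]."*  Followed by: *"This is the main result of the whole sequence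
of papers of the present author on non-Abelian gauge field theories. … has not been published yet, so we have
Theorem 1 with the assumption."*  Quantifier reading: ∃ γ > 0 (after all construction constants), ∀ runs whose
couplings satisfy `0 < g_k ≤ γ`, k ≤ K (`Setup.Flow.InInterval`), ∀ k ≤ K, the §2 [III] description holds. [cite: Balaban1989LargeFieldII, Thm 1 p.355] -/
def Thm1Printed (C : Construction) : Prop :=
  ∃ γ : ℝ, 0 < γ ∧ ∀ P : B12.RunParams, (C P).flow.InInterval γ P.K → ∀ k, k ≤ P.K → (C P).Sect2Form k

/-! ## The ultraviolet-stability bounds: (0.1) here and (2.50) of [III], two printed dependence clauses -/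

/-- The two-sided inequality itself, for one run, one step `k`, one configuration `V`, with exponent constants `Em`,
`Ep`: `χ_k · exp[−(1/g_k²) A(U_k(V_k)) − E₋ |T_η|] ≤ ρ_k(V_k) ≤ exp(E₊ |T_η|)` ((0.1) pp. 355–356; (2.50) of [III]
p. 264). [cite: Balaban1989LargeFieldII, (0.1) pp.355–356] -/
def UVIneq (D : RunData) (k : ℕ) (V : D.Cfg k) (Em Ep : ℝ) : Prop :=
  D.χ k V * Real.exp (-(1 / (D.flow.g k) ^ 2 * D.wilsonBG k V) - Em * (D.numSites k : ℝ)) ≤ D.ρ k V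
    ∧ D.ρ k V ≤ Real.exp (Ep * (D.numSites k : ℝ))

/-- (0.1) for fixed `γ, E₋, E₊`: p. 356 [2] *"with the constants E_−, E_+ independent of k, T_η, U_k"* — i.e. `E₋,
E₊` are chosen BEFORE the run (`K`, `m`, hence `T_η`), the step `k` and the configuration. [cite: Balaban1989LargeFieldII, (0.1) p.356] -/
def UV01With (C : Construction) (γ Em Ep : ℝ) : Prop :=
  ∀ P : B12.RunParams, (C P).flow.InInterval γ P.K → ∀ k, k ≤ P.K → ∀ V : (C P).Cfg k, UVIneq (C P) k V Em Ep

/-- **(0.1)** as printed (pp. 355–356 [1–2]): *"As an immediate consequence of this theorem, we get the ultraviolet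
stability bounds of the same type as for superrenormalizable models in [16]:
χ_k exp[−(1/g_k²)A(U_k) − E₋|T_η|] ≤ ρ_k ≤ exp E₊|T_η| , (0.1) with the constants E_−, E_+ independent of k, T_η,
U_k."* — under the hypothesis of Theorem 1 ([16] = [Balaban1985UV3], `…B10.Thm1Printed`).  QUANTIFIER READING, recorded
as the STRONGER one (revision v5; cell GAPS G-pv24-1): here `E₋, E₊` are chosen before the RUN (before `K, m, g₀`), i.e.
uniformly over the whole ]0, γ]-family and hence in the coupling — a uniformity the printed clause does not list ("k, T_η,
U_k" is silent on g_k, g₀) and which is contradicted for `E₊` at k = 0, U = 1, as soon as runs with arbitrarily small bare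
coupling occur, UNDER THE CELL'S TYPED COUNT of the printed normalisation ρ₀ = exp[−(1/g₀²)A − E] ([III] Thm 1 p. 262, E
from (1.15) p. 249 and p. 254): sibling module `B16B10Shape`, `not_uvBound01_of_smallCouplings` (E₊ ≥ c·log g₀⁻¹ − C₀ under
the typed hypotheses `LogNormalised` — whose reader's leaves are `ZLower` (PROVED for G = U(N), SU(N) in the sibling
`B16ZLower`, revision v7), the bond count `TstarCount` (PROVED in dictionary form in the sibling `B16TstarCount`, revision v9,
cell GAPS C-r2.28) and `EflBound` (OPEN: author question (ii) of cell GAPS G-pv24-1, put to the author) — and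
`SmallCouplingsOccur`; a CONDITIONAL kernel result about a reading, not a printed statement: revision v6, cell GAPS G-ref2-11
(a); revision v10: the pair (`LogNormalised`, `SmallCouplingsOccur`) as typed is mis-cut
at K = 0 and the repaired exact form is the sibling's `B16SmallCouplings.not_uvBound01_of_betaUpper` /
`not_uvBound01_of_leaves` — see the module docstring, cell GAPS C-pv24g4-1 / C-r2.33; revision v11: its leaf family
INSTANTIATED for G = SU(N) in the sibling `B16LeafFamily.not_uvBound01_of_torusLeaves` — the carrier identification
discharged there, remaining inputs (1)–(4) of the module docstring, cell GAPS C-pv24g5-1 / C-r2.35).  Read PER RUN — E± after the run and before k and the configuration,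
i.e. "independent of k, U_k" inside one run (T_η is fixed by the run, so that word of the clause is vacuous there) — it is
`UVBound01PerRun` below, a theorem of the pin given only χ_k ≥ 0 (revision v6, cell GAPS G-ref2-11 (c)); read with E±
depending on the BARE coupling only (one pair for all runs starting from g₀: every K, m, hence every T_η — the weakest
reading in which "independent of T_η" has content) it is `UVBound01PerBare` below, which follows from the compact-window
statement under the flow inequality (2.6) [III] — printed p. 255, UNPROVED in print (the cell's located step (i), hypothesis
`B14FlowStep` / `B14.FlowIneq26`) — and is NOT derivable from the pin (kernel counter-models
`B16PerBareCounter.pin_not_implies_perBare`, `B16PerBareCounter.pin_floor_not_implies_perBare`) (revision v7, cell GAPS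
G-ref2-16 (a); v8, G-ref2-19 (c)).  The
reading all three printed clauses ((0.1) p. 356, [16] (5) pp. 256–257, [III] (2.50) p. 264)
support is the compact-window one, `B16B10Shape.UVBound01Compact` (one pair E± per coupling window [g_min, γ]; ⟸ `Cor3_250`
with e± locally bounded on ]0, γ], `B16B10Shape.uvCompact_of_cor3_continuousOn_Ioc`; = [16]'s audited reading
`B10.Thm1PrintedCompact`, cell GAPS G-B10-01).  This declaration is kept unchanged (importers use it by name); the pinned
(B) is `EndStatementBPrinted` below. [cite: Balaban1989LargeFieldII, (0.1) pp.355–356] -/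
def UVBound01 (C : Construction) : Prop :=
  ∃ γ : ℝ, 0 < γ ∧ ∃ Em Ep : ℝ, UV01With C γ Em Ep

/-- (2.50) of [III] for fixed `γ` and fixed dependence FUNCTIONS `em, ep : ℝ → ℝ` of the running coupling: [III]
Cor. 3 p. 264 *"constants E_−, E_+ independent of η and T, but depending on g_k"* — i.e. `E_± = e_±(g_k)` may vary
with the VALUE `g_k` but not with `η = L^{-k}`, the torus `T`, or `V_k`. [cite: Balaban1988Convergent, Cor. 3 (2.50) p.264] -/
def Cor3With (C : Construction) (γ : ℝ) (em ep : ℝ → ℝ) : Prop :=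
  ∀ P : B12.RunParams, (C P).flow.InInterval γ P.K → ∀ k, k ≤ P.K → ∀ V : (C P).Cfg k,
    UVIneq (C P) k V (em ((C P).flow.g k)) (ep ((C P).flow.g k))

/-- **[III] Corollary 3 (Ultraviolet Stability)**, verbatim ([Balaban1988Convergent] p. 264 [22]): *"Under the
assumptions of Theorem 1 there exist constants E_−, E_+ independent of η and T, but depending on g_k, such that
χ_k(T_η) exp[−(1/g_k²) A(U_k(V_k)) − E₋|T_η|] ≤ ρ_k(V_k) ≤ e^{E₊|T_η|} . (2.50)"*  "The assumptions of Theorem 1"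
[III] = "{g_k} … satisfies the inequalities (I.0.33)" — a reference with no matching equation number in [I] (whose
§0 ends at (0.32); cell GAPS.md G2); typed here with the interval hypothesis of Theorem 1 above, the reading this
paper itself uses.  p. 387 [33]: *"This implies the inequality (2.50) [III], hence Corollary 3."*; p. 391 [37]:
*"This completes the proof of Theorem 1 and Corollary 3."* [cite: Balaban1988Convergent, Cor. 3 (2.50) p.264] -/
def Cor3_250 (C : Construction) : Prop :=
  ∃ γ : ℝ, 0 < γ ∧ ∃ em ep : ℝ → ℝ, Cor3With C γ em ep

/-- Bookkeeping (the two printed dependence clauses related exactly): [III]'s reading implies (0.1)'s reading as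
soon as the dependence functions `e_±(·)` are bounded above on ]0, γ] (e.g. monotone, or continuous on [0, γ]) —
given only the sign convention `χ_k ≥ 0`.  No analytic content. [folklore] -/
theorem uv01_of_cor3 (C : Construction) (γ : ℝ) (em ep : ℝ → ℝ) (Em Ep : ℝ)
    (hsign : SignConventions C)
    (hcor : Cor3With C γ em ep)
    (hm : ∀ x, 0 < x → x ≤ γ → em x ≤ Em) (hp : ∀ x, 0 < x → x ≤ γ → ep x ≤ Ep) :
    UV01With C γ Em Ep := by
  intro P hγ k hk V
  obtain ⟨hlow, hup⟩ := hcor P hγ k hk V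
  obtain ⟨hgpos, hgle⟩ := hγ k hk
  have hχ : 0 ≤ (C P).χ k V := hsign P k V
  have hvol : (0 : ℝ) ≤ ((C P).numSites k : ℝ) := Nat.cast_nonneg _
  have hem : em ((C P).flow.g k) ≤ Em := hm _ hgpos hgle
  have hep : ep ((C P).flow.g k) ≤ Ep := hp _ hgpos hgle
  refine ⟨?_, ?_⟩
  · have hexp : Real.exp (-(1 / ((C P).flow.g k) ^ 2 * (C P).wilsonBG k V) - Em * ((C P).numSites k : ℝ))
        ≤ Real.exp (-(1 / ((C P).flow.g k) ^ 2 * (C P).wilsonBG k V)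
            - em ((C P).flow.g k) * ((C P).numSites k : ℝ)) := by
      apply Real.exp_le_exp.mpr
      have := mul_le_mul_of_nonneg_right hem hvol
      linarith
    exact le_trans (mul_le_mul_of_nonneg_left hexp hχ) hlow
  · have hexp : Real.exp (ep ((C P).flow.g k) * ((C P).numSites k : ℝ))
        ≤ Real.exp (Ep * ((C P).numSites k : ℝ)) := by
      apply Real.exp_le_exp.mpr
      exact mul_le_mul_of_nonneg_right hep hvol
    exact le_trans hup hexp

/-- Corollary of the bookkeeping: with bounded dependence functions, `Cor3_250 → UVBound01`. [folklore] -/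
theorem uvBound01_of_cor3_bounded (C : Construction) (hsign : SignConventions C)
    (h : ∃ γ : ℝ, 0 < γ ∧ ∃ em ep : ℝ → ℝ, Cor3With C γ em ep ∧
      (∃ Em : ℝ, ∀ x, 0 < x → x ≤ γ → em x ≤ Em) ∧ (∃ Ep : ℝ, ∀ x, 0 < x → x ≤ γ → ep x ≤ Ep)) :
    UVBound01 C := by
  obtain ⟨γ, hγ, em, ep, hcor, ⟨Em, hEm⟩, ⟨Ep, hEp⟩⟩ := h
  exact ⟨γ, hγ, Em, Ep, uv01_of_cor3 C γ em ep Em Ep hsign hcor hEm hEp⟩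

/-- Converse direction is trivial: constants are constant functions. [folklore] -/
theorem cor3_of_uvBound01 (C : Construction) (h : UVBound01 C) : Cor3_250 C := by
  obtain ⟨γ, hγ, Em, Ep, h⟩ := h
  exact ⟨γ, hγ, fun _ => Em, fun _ => Ep, fun P hP k hk V => h P hP k hk V⟩

/-! ## Where the unproved Theorem 2 of [I] would enter -/

/-- **[I] Theorem 2** (stated without proof; `…B12.Thm2Printed`, verbatim text and quantifier reading there) for the
small-field part of this construction: d = 4, G = SU(2) fixed inside `C`, `L` = the block size. [cite: Balaban1987RG1, Thm 2 (0.31) p.259] -/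
def Thm2Shape (C : Construction) (L : ℝ) : Prop := B12.Thm2Printed C.toB12 L

/-- The conclusion of Theorem 1 WITHOUT the interval hypothesis, in [I] Theorem 2's regime: for the fixed torus
exponent m, every sufficiently small renormalized coupling g and every spacing ε = L^{-K} there is a bare coupling g₀
with g_K = g for which all ρ_k, k ≤ K, have the §2 [III] form.  (p. 355: *"Theorem 2 of [I] allows us to remove the
assumption on the effective coupling constants in the above theorem"*.) [cite: Balaban1989LargeFieldII, p.355] -/
def Sect2Unconditional (C : Construction) : Prop :=
  ∀ m : ℕ, ∃ gstar : ℝ, 0 < gstar ∧ ∀ g : ℝ, 0 < g → g ≤ gstar →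
    ∀ K : ℕ, ∃ g0 : ℝ, (C ⟨K, m, g0⟩).flow.g K = g ∧ ∀ k, k ≤ K → (C ⟨K, m, g0⟩).Sect2Form k

/-- Bookkeeping: exactly how [I] Thm 2 (unproved in print) would discharge the hypothesis of Theorem 1.  Pure
quantifier logic (take γ = min γ₁ γ₂); no analytic content. [folklore] -/
theorem sect2_unconditional_of_Thm2 (C : Construction) (L : ℝ)
    (h1 : Thm1Printed C) (h2 : Thm2Shape C L) : Sect2Unconditional C := by
  obtain ⟨γ₁, hγ₁, H1⟩ := h1
  intro m
  obtain ⟨γ₂, hγ₂, H2⟩ := h2 m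
  obtain ⟨gstar, hgstar, Hg⟩ := H2 (min γ₁ γ₂) (lt_min hγ₁ hγ₂) (min_le_right _ _)
  refine ⟨gstar, hgstar, fun g hg hgle K => ?_⟩
  obtain ⟨β, β', -, -, HK⟩ := Hg g hg hgle
  obtain ⟨g0, hint, hgK, -⟩ := HK K
  refine ⟨g0, hgK, fun k hk => H1 ⟨K, m, g0⟩ ?_ k hk⟩
  intro j hj
  obtain ⟨hpos, hle⟩ := hint j hj
  exact ⟨hpos, le_trans hle (min_le_left _ _)⟩

/-- Same discharge for the bound (0.1): with [I] Thm 2, `E₋, E₊` (chosen once, before m, g, ε) hold without the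
coupling hypothesis in Theorem 2's regime. [folklore] -/
theorem uv_unconditional_of_Thm2 (C : Construction) (L : ℝ)
    (h01 : UVBound01 C) (h2 : Thm2Shape C L) :
    ∃ Em Ep : ℝ, ∀ m : ℕ, ∃ gstar : ℝ, 0 < gstar ∧ ∀ g : ℝ, 0 < g → g ≤ gstar →
      ∀ K : ℕ, ∃ g0 : ℝ, (C ⟨K, m, g0⟩).flow.g K = g ∧
        ∀ k, k ≤ K → ∀ V : (C ⟨K, m, g0⟩).Cfg k, UVIneq (C ⟨K, m, g0⟩) k V Em Ep := by
  obtain ⟨γ₁, hγ₁, Em, Ep, H1⟩ := h01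
  refine ⟨Em, Ep, fun m => ?_⟩
  obtain ⟨γ₂, hγ₂, H2⟩ := h2 m
  obtain ⟨gstar, hgstar, Hg⟩ := H2 (min γ₁ γ₂) (lt_min hγ₁ hγ₂) (min_le_right _ _)
  refine ⟨gstar, hgstar, fun g hg hgle K => ?_⟩
  obtain ⟨β, β', -, -, HK⟩ := Hg g hg hgle
  obtain ⟨g0, hint, hgK, -⟩ := HK K
  refine ⟨g0, hgK, fun k hk V => H1 ⟨K, m, g0⟩ ?_ k hk V⟩
  intro j hj
  obtain ⟨hpos, hle⟩ := hint j hj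
  exact ⟨hpos, le_trans hle (min_le_left _ _)⟩

/-! ## The end statement (B): Theorem 1 ∧ (0.1) in the run-uniform reading (the pin of revisions v1–v4; the v5 pin is
`EndStatementBPrinted`, next section) -/

/-- **(B), STRONGER RECORDED READING** (the cell's pin in revisions v1–v4; superseded AS THE PIN by `EndStatementBPrinted`
in v5 — cell GAPS G-pv24-1 / C-r2.23; a filed declaration is never redefined, cf. cell DIVERGENCE D-b10.3): Theorem 1 ∧
(0.1) with (0.1) in the run-uniform reading `UVBound01` (E± before the run, hence uniform in the coupling).  It implies the
pin (`endStatementBPrinted_of_endStatementB`); the converse needs witnessing dependence functions of [III] Cor. 3 bounded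
above on ]0, γ] (`endStatementB_of_printed_bounded`), which fails for e₊ once small bare couplings occur UNDER THE CELL'S
TYPED NORMALISATION COUNT of ρ₀ (`B16B10Shape.LogNormalised`, whose reader's leaves are `ZLower` — PROVED for U(N), SU(N) in
`B16ZLower` —, the bond count `TstarCount` — PROVED in dictionary form in `B16TstarCount`, revision v9 — and `EflBound` — OPEN,
author question (ii) of cell GAPS G-pv24-1, put to the author; `B16B10Shape.ep_unbounded_of_cor3`,
`B16B10Shape.not_uvBound01_of_smallCouplings`: under those hypotheses `¬ EndStatementB`) — a conditional kernel result, not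
a printed statement (revision v6, cell GAPS G-ref2-11 (a); revision v10: the pair (`LogNormalised`, `SmallCouplingsOccur`) as typed is mis-cut
at K = 0 and the repaired exact form is the sibling's `B16SmallCouplings.not_uvBound01_of_betaUpper` /
`not_uvBound01_of_leaves` — see the module docstring, cell GAPS C-pv24g4-1 / C-r2.33; revision v11: its leaf family
INSTANTIATED for G = SU(N) in the sibling `B16LeafFamily.not_uvBound01_of_torusLeaves` — the carrier identification
discharged there, remaining inputs (1)–(4) of the module docstring, cell GAPS C-pv24g5-1 / C-r2.35; the `LogNormalised` hypothesis of
`ep_unbounded_of_cor3` carries the same K = 0 cut, its per-run content `B16B10Shape.ep_lower_of_uvIneq_zero` being unaffected).  Importers (`B14Cor3`, `DagBinding`, `FlowStepRuns`, `T4Continuum`, `B16B10Shape`) use this name and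
all carry that boundedness as an explicit hypothesis. [cite: Balaban1989LargeFieldII, Thm 1 + (0.1) pp.355–356] -/
def EndStatementB (C : Construction) : Prop := Thm1Printed C ∧ UVBound01 C

/-- *"As an immediate consequence of this theorem, we get … (0.1)"* (p. 355): the printed claim that (0.1) follows
from Theorem 1 is the implication `Sect2Form ⇒ (2.50)`, i.e. [III] Cor. 3; typed as a named leaf so that the dependence
is visible ([III] p. 264 derives (2.50) from (2.49): *"we estimate the integral ∫dV_kρ_k by a sum of terms similar to the
one considered in Sect. 3 [6], e.g., see (3.42) … hence we have the same result for this scale"* — [6] = entry 6 of [I]'s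
list = [Balaban1982Higgs2] ((Higgs)₂,₃ II, CMP 86), §3 (3.42), cell paper B2; NOT [16] = [Balaban1985UV3] as an earlier
revision of this docstring said; cell GAPS.md G-r2.5, G-B16-08 (c)). [cite: Balaban1988Convergent, Cor. 3 p.264] -/
def Cor3Leaf (C : Construction) : Prop := Thm1Printed C → Cor3_250 C

/-- Bookkeeping: Theorem 1 + the Cor. 3 leaf + boundedness of the dependence functions on ]0, γ] ⇒ (B). [folklore] -/
theorem endStatement_of_leaves (C : Construction) (hsign : SignConventions C)
    (h1 : Thm1Printed C) (hcor : Cor3Leaf C)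
    (hbdd : ∀ γ : ℝ, 0 < γ → ∀ em ep : ℝ → ℝ, Cor3With C γ em ep →
      (∃ Em : ℝ, ∀ x, 0 < x → x ≤ γ → em x ≤ Em) ∧ (∃ Ep : ℝ, ∀ x, 0 < x → x ≤ γ → ep x ≤ Ep)) :
    EndStatementB C := by
  refine ⟨h1, ?_⟩
  obtain ⟨γ, hγ, em, ep, hc⟩ := hcor h1
  obtain ⟨hEm, hEp⟩ := hbdd γ hγ em ep hc
  exact uvBound01_of_cor3_bounded C hsign ⟨γ, hγ, em, ep, hc, hEm, hEp⟩

/-! ## The end statement (B), PINNED in its printed [III] form (revision v5; cell GAPS G-pv24-1, ruling C-r2.23)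

p. 391 [37]: *"This completes the proof of Theorem 1 and Corollary 3."* — the two statements the paper declares proved are
Theorem 1 (p. 355) and [III] Corollary 3 (2.50) (p. 264: *"constants E_−, E_+ independent of η and T, but depending on
g_k"*).  (0.1)'s own clause (p. 356: *"with the constants E_−, E_+ independent of k, T_η, U_k"*) lists the step, the
lattice and the configuration and is SILENT on the coupling.  Read uniformly in the coupling (`UVBound01`: E± before the
run) it is contradicted at k = 0, U = 1, once arbitrarily small bare couplings occur, UNDER THE CELL'S TYPED COUNT of the
printed normalisation ρ₀ = exp[−(1/g₀²)A − E] ([III] Thm 1 p. 262) — kernel `B16B10Shape.not_uvBound01_of_smallCouplings`,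
hypotheses `LogNormalised` (reader's leaves: `EflBound` OPEN — author question (ii) of cell GAPS G-pv24-1, put to the author;
`ZLower` proved for U(N), SU(N) in `B16ZLower`; the bond count `TstarCount` proved in dictionary form in `B16TstarCount` —
revision v9, cell GAPS C-r2.28) and `SmallCouplingsOccur`: a conditional result about a reading, not a
printed statement (revision v6, cell GAPS G-ref2-11 (a); revision v10: the pair (`LogNormalised`, `SmallCouplingsOccur`) as typed is mis-cut
at K = 0 and the repaired exact form is the sibling's `B16SmallCouplings.not_uvBound01_of_betaUpper` /
`not_uvBound01_of_leaves` — see the module docstring, cell GAPS C-pv24g4-1 / C-r2.33; revision v11: its leaf family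
INSTANTIATED for G = SU(N) in the sibling `B16LeafFamily.not_uvBound01_of_torusLeaves` — the carrier identification
discharged there, remaining inputs (1)–(4) of the module docstring, cell GAPS C-pv24g5-1 / C-r2.35); read PER RUN (E± after the run, before the step and the
configuration — "independent of k, U_k" inside one run, where T_η is fixed by (K, m) and that word of the clause is
vacuous) it is `UVBound01PerRun` (next section), a THEOREM of the pin given only χ_k ≥ 0 (revision v6, cell GAPS G-ref2-11
(c)); read with E± depending on the BARE coupling only — one pair for all runs starting from g₀, every K and m, hence every
lattice T_η: the weakest reading keeping "independent of T_η" non-vacuous — it is `UVBound01PerBare` (next section), which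
does NOT follow from the pin (for fixed g₀ the finite maxima max_{k ≤ K} e±(g_k) need not be bounded in K unless e± is
bounded on the coupling window the flow visits — kernel counter-models `B16PerBareCounter.pin_not_implies_perBare` (model M1)
and `B16PerBareCounter.pin_floor_not_implies_perBare` (model M2, in which even the (2.6)-floor holds); revision v8, cell GAPS
G-ref2-19 (c); for EVERY floor parameter β₀ > 0 — p. 255 [III] *"β₀ > 0 can be chosen arbitrarily small"* — models M5(β₀),
`B16PerBareCounter.pin_floor_not_implies_perBare_sharp`, revision v9 / that module's v2) but follows from the compact-window
statement under the flow inequality (2.6) [III] p. 255, g_0 ≤ (1+β₀) g_k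
— PRINTED there, UNPROVED in print: the cell's located step (i) (hypothesis `B14FlowStep` / `B14.FlowIneq26`, cell
`MISSING-B14.md`), the same status as the use of [I] Thm 2 (revision v7, cell GAPS G-ref2-16 (a); v8, G-ref2-19 (c)); read on
compact coupling windows it is
`B16B10Shape.UVBound01Compact`, which follows from `Cor3With` + local boundedness of e± on ]0, γ]
(`B16B10Shape.uvCompact_of_cor3_continuousOn_Ioc`) and equals [16]'s audited reading `B10.Thm1PrintedCompact`
(`B16B10Shape.uvCompact_iff_thm1CompactB10`; cell GAPS G-B10-01).  Hence the pin: (B) := Theorem 1 ∧ [III] Cor. 3, both in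
their printed CONDITIONAL form (interval hypothesis on the running couplings).  `EndStatementB` (Theorem 1 ∧ `UVBound01`)
stays on file as the STRONGER recorded reading; the three theorems below relate the two exactly (no analytic content). -/

/-- **(B), PINNED (revision v5)** = what the series asserts at its end, in its printed CONDITIONAL form: Theorem 1 (p. 355)
∧ [III] Corollary 3 (2.50) (p. 264, constants "depending on g_k") — p. 391 [37]: *"This completes the proof of Theorem 1
and Corollary 3."*  (0.1) p. 356 read PER RUN (E± after the run, before k and the configuration: "independent of k, U_k"
inside one run, T_η being fixed there) is `UVBound01PerRun` (next section) and FOLLOWS from this pin given only χ_k ≥ 0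
(`uvBound01PerRun_of_endStatementBPrinted`; revision v6, cell GAPS G-ref2-11 (c)); read with E± depending on the BARE
coupling only (all K, m — the weakest reading in which "independent of T_η" is not vacuous) it is `UVBound01PerBare` (next
section), which follows from the compact-window statement `B16B10Shape.UVBound01Compact` (sibling module; ⟸ `Cor3_250`
with e± locally bounded on ]0, γ]) under the flow inequality (2.6) [III] (printed p. 255, UNPROVED in print — the cell's
located step (i), hypothesis `B14FlowStep` / `B14.FlowIneq26`), and is NOT derivable from this pin alone (kernel
counter-models `B16PerBareCounter.pin_not_implies_perBare` / `B16PerBareCounter.pin_floor_not_implies_perBare`) (revision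
v7, cell GAPS G-ref2-16 (a); v8, G-ref2-19 (c)); the cross-run, cross-lattice content of the printed clauses is carried by this pin through [III]
Cor. 3's *"independent of η and T"* for the dependence FUNCTIONS e±(g_k); the run-uniform reading is `EndStatementB` above
(stronger; cell GAPS G-pv24-1). [cite: Balaban1989LargeFieldII, Thm 1 p.355 + p.391] -/
def EndStatementBPrinted (C : Construction) : Prop := Thm1Printed C ∧ Cor3_250 C

/-- The stronger recorded reading implies the pin (constants are constant functions: `cor3_of_uvBound01`). [folklore] -/
theorem endStatementBPrinted_of_endStatementB (C : Construction) (h : EndStatementB C) : EndStatementBPrinted C :=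
  ⟨h.1, cor3_of_uvBound01 C h.2⟩

/-- Bookkeeping: Theorem 1 + the Cor. 3 leaf ⇒ the pin — with NO boundedness hypothesis on the dependence functions
(contrast `endStatement_of_leaves`). [folklore] -/
theorem endStatementBPrinted_of_leaves (C : Construction) (h1 : Thm1Printed C) (hcor : Cor3Leaf C) :
    EndStatementBPrinted C :=
  ⟨h1, hcor h1⟩

/-- Conversely, the pin gives the stronger reading when the dependence functions of every [III] Cor. 3 witness are bounded
above on ]0, γ] (given `χ_k ≥ 0`) — a hypothesis that is undischargeable for e₊ once small bare couplings occur UNDER THE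
CELL'S TYPED NORMALISATION COUNT of ρ₀ (`B16B10Shape.ep_unbounded_of_cor3`, itself conditional on
`B16B10Shape.LogNormalised`, whose reader's leaves are `ZLower` (proved for U(N), SU(N) in `B16ZLower`), the bond count
`TstarCount` (proved in dictionary form in `B16TstarCount`, revision v9) and `EflBound` (open: author question (ii) of cell GAPS
G-pv24-1, put to the author) — a conditional result about a reading, not a printed statement: revision v6, cell GAPS G-ref2-11
(a); revision v10: `ep_unbounded_of_cor3`'s `LogNormalised` hypothesis quantifies over the zero-step runs too and is, for
a positive slope c (`ep_unbounded_of_cor3` itself carries no hypothesis `0 < c`; revision v11, XREAD C-pv12g8-1 A2),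
unsatisfiable on forward-generated constructions with non-empty lattices and sub-unit zero-step densities
(`B16SmallCouplings.not_logNormalised_of_zeroStep`); its per-run content `B16B10Shape.ep_lower_of_uvIneq_zero` — e₊(g₀) ≥
c·log g₀⁻¹ − C₀ on a run with a non-empty lattice carrying `UnitConfigLog` and the step-0 upper inequality — is unaffected,
and for ¬`UVBound01` the repaired exact form is `B16SmallCouplings.not_uvBound01_of_betaUpper` / `not_uvBound01_of_leaves`,
cell GAPS C-pv24g4-1 / C-r2.33).  Same shape as `endStatement_of_leaves`. [folklore] -/
theorem endStatementB_of_printed_bounded (C : Construction) (hsign : SignConventions C) (h : EndStatementBPrinted C)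
    (hbdd : ∀ γ : ℝ, 0 < γ → ∀ em ep : ℝ → ℝ, Cor3With C γ em ep →
      (∃ Em : ℝ, ∀ x, 0 < x → x ≤ γ → em x ≤ Em) ∧ (∃ Ep : ℝ, ∀ x, 0 < x → x ≤ γ → ep x ≤ Ep)) :
    EndStatementB C := by
  obtain ⟨γ, hγ, em, ep, hc⟩ := h.2
  obtain ⟨hEm, hEp⟩ := hbdd γ hγ em ep hc
  exact ⟨h.1, uvBound01_of_cor3_bounded C hsign ⟨γ, hγ, em, ep, hc, hEm, hEp⟩⟩

/-! ## (0.1) read PER RUN and PER BARE COUPLING — which readings of its clause the pin yields (revisions v6–v8; cell GAPS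
G-ref2-11 (c), G-ref2-16 (a), G-ref2-19 (c))

UNDER-CLAIM GUARD (cell REFEREE R19.1, referee ref2 gen 10; the per-run part lifted from that seat's scratch
`b2b-balaban-ref2/gen10/PerRun01.lean`, farm-checked there rc 0, with the monotonicity step of the sibling module
`B16B10Shape.uvIneq_mono` re-proved locally because that module imports this one; the bare-coupling part answers cell REFEREE
R24.3, referee ref2 gen 15).  The clause of (0.1), p. 356 [2] — *"with the constants E_−, E_+ independent of k, T_η, U_k"* —
names the step, the lattice and the configuration.  Two readings weaker than [III] Cor. 3 are typed here:

* PER RUN (`UVBound01PerRun`, revision v6): for each run P of the ]0, γ]-family (K, m, the bare coupling — hence the whole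
  coupling sequence AND the lattice T_η) ONE pair E₋, E₊ serving every step k ≤ K and every configuration: "independent of
  k, U_k" inside one run.  Inside one run T_η is FIXED, so the printed word "T_η" is VACUOUS in this reading (cell REFEREE
  R24.3 / GAPS G-ref2-16 (a)); it is the weakest reading on file, and it FOLLOWS from the pin's second conjunct `Cor3_250` by
  a FINITE MAXIMUM over k ≤ K, with no boundedness or continuity hypothesis on e± — only χ_k ≥ 0 (`SignConventions`).
* PER BARE COUPLING (`UVBound01PerBare`, revision v7): for each bare coupling g₀ ∈ ]0, γ] ONE pair E₋, E₊ serving EVERY run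
  of the family that starts from g₀ — every K and m, hence every lattice T_η —, every step k ≤ K and every configuration:
  "independent of k, T_η, U_k" with all three words non-vacuous, E± depending on the one datum the clause does not list (the
  coupling).  It sits strictly above `UVBound01PerRun`, and below the compact-window reading `B16B10Shape.UVBound01Compact`
  UNDER the (2.6)-floor — INCOMPARABLE with it otherwise (revision v9: `B16PerBareCounter` v2, `perBare_not_implies_compact` /
  `compact_not_implies_perBare`; cell FINAL-STATEMENT §6 v10, correcting the unqualified "between" of v7–v8 of this
  sentence) —, and is NOT
  DERIVABLE from the pin: for fixed g₀ the finite maxima max_{k ≤ K} e±(g_k) need not be bounded in K unless e± is bounded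
  on the coupling window the flow visits — KERNEL COUNTER-MODELS (revision v8, cell REFEREE R27.1 (iv) / GAPS G-ref2-19 (c))
  in the sibling module `B16PerBareCounter` (toy carriers inside `Construction`: one configuration, one site, χ ≡ 0,
  ρ_k = exp e(g_k) — about the LOGICAL FORM of the typed readings, nothing about T. Bałaban's densities): model M1
  (g_k = g₀/(k+1), e₊ = 1/x locally bounded and continuous on ]0, γ]; pin ∧ `Cor3With` at every γ ∧
  `B16B10Shape.UVBound01Compact`, yet ¬`UVBound01PerBare` — the (2.6)-floor fails: `pin_not_implies_perBare`,
  `compact_not_implies_perBare`, `m1_floor_fails`) and model M2 (g_k = g₀·(k+2)/(2k+2) ∈ [g₀/2, g₀], so the (2.6)-floor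
  HOLDS with β₀ = 1, yet ¬`UVBound01PerBare` — no locally bounded e₊ serves it: `pin_floor_not_implies_perBare`,
  `m2_no_locally_bounded_witness`, `m2_not_uvCompact`, `perRun_not_implies_perBare`); COMPLETED at revision v9 by that
  module's v2 §4 (unit b2b-balaban-r2-g10, XREAD cell GAPS C-pv24g3-8 / REFEREE R34): models M5(β₀) for EVERY β₀ > 0
  (g_k = g₀·c_k with (1+β₀)c_k > 1, c_k ↓ 1/(1+β₀): pin ∧ χ ≥ 0 ∧ (2.6)-floor(β₀), yet ¬`UVBound01PerBare` —
  `pin_floor_not_implies_perBare_sharp`, `perRun_floor_not_implies_perBare`, `m5_no_locally_bounded_witness`), the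
  floor-free theorem `perRun_of_compact` (`B16B10Shape.UVBound01Compact C → UVBound01PerRun C` for EVERY construction, by a
  finite minimum over the visited couplings), the constant-flow models M3 (`UVBound01PerBare` ∧ floor ∧
  ¬`B16B10Shape.UVBound01Compact`: `perBare_not_implies_compact`, `perBare_floor_not_implies_compact`) and M4 (compact ∧ per
  bare ∧ floor ∧ ¬`UVBound01`: `compact_perBare_floor_not_implies_uvBound01`), and the step-indexed model M6 (the pin is
  strictly above `UVBound01PerRun`: `perRun_not_implies_cor3`) — so that the four typed readings `UVBound01` /
  `B16B10Shape.UVBound01Compact` / `UVBound01PerBare` / `UVBound01PerRun` are PAIRWISE INEQUIVALENT on toy carriers: without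
  (2.6) the diamond `UVBound01` ⊊ Compact ⊊ PerRun, `UVBound01` ⊊ PerBare ⊊ PerRun with Compact and PerBare incomparable,
  with the (2.6)-floor the strict chain `UVBound01` ⊊ Compact ⊊ PerBare ⊊ PerRun (the typings are recorded, not
  adjudicated: cell DIVERGENCE D-r2.14).  It follows from the window statement (`uvBound01PerBare_of_window_floor`, whose
  window hypothesis is `B16B10Shape.UV01Window` unfolded — so that `B16B10Shape.UVBound01Compact` plus the floor gives it in
  one line there: the by-name bridge `B16B10Shape.uvPerBare_of_uvCompact_floor`, that module's v2.2 §5, unit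
  b2b-balaban-pv24-g3, XREAD cell GAPS C-pv13g4-8; the floor a HYPOTHESIS there too) — equivalently from `Cor3With` with e±
  bounded above on every window [g_min, γ], g_min > 0
  (`uvBound01PerBare_of_cor3_floor`) — under the printed flow inequality (2.6) of [III] p. 255 [13], last member, at m = 0:
  *"g_m ≤ (1+β₀) g_n , (2.6) where n > m, and β₀ > 0 can be chosen arbitrarily small, if g is sufficiently small."* (render
  p013 re-read; typed for a whole flow as `B14.FlowIneq26`, second conjunct), i.e. g_0 ≤ (1+β₀) g_k for k ≤ K, so a run
  from g₀ stays in the window [g₀/(1+β₀), γ] (with β-functions ≥ 0 along the flow the couplings are even monotone,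
  `B14FlowStep.g_mono_of_betaNonneg` — a pointwise sign that is not printed, cell GAPS G-r2.1).  STATUS OF (2.6) (revision
  v8, cell REFEREE R27.1 (iii) / GAPS G-ref2-19 (c)): PRINTED, but NOT PROVED in print — p. 255 [13] continues *"The
  inequalities follow from the renormalization group equations (0.20) [I], and from the properties of the β-functions."*
  (text layer p0013 L30–32, re-read at v8) and no proof is printed in [III] (none found by the cell in [I]–[IV] or here
  either: cell FINAL-STATEMENT §5(c)); it is the cell's located UNPROVED-IN-PRINT step (i) (hypothesis `B14FlowStep` /
  `B14.FlowIneq26`; cell `MISSING-B14.md`: what IS derivable from (0.20) is kernel-proved there and in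
  `B14.flowIneq26_of_rg_two_sided`, the last member needing an unprinted SIGN / partial-sum property of the β-functions,
  cell GAPS G-r2.1) — the same status as the use of [I] Thm 2 on p. 355.  Hence `UVBound01PerBare` as obtained here is
  CONDITIONAL on the pin's interval hypothesis AND on (2.6).

So, exactly: (0.1) read inside one run ("independent of k, U_k") is a consequence of `EndStatementBPrinted`; the readings that
give "independent of T_η" content ACROSS runs — per bare coupling, compact window, run-uniform — are not derivable from the
pin alone (counter-models `B16PerBareCounter`, above): the first two need local boundedness of e± on ]0, γ] (mild, unprinted;
plus (2.6) — printed, UNPROVED in print, located step (i) `B14FlowStep` — for the first; BOTH needs kernel-witnessed as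
load-bearing, by models M2 and M1 respectively), the third
(`UVBound01`) is the recorded stronger reading, conditionally refuted (`B16B10Shape.not_uvBound01_of_smallCouplings` —
repaired exact form `B16SmallCouplings.not_uvBound01_of_betaUpper` / `not_uvBound01_of_leaves`, revision v10, leaf family
instantiated for SU(N) in `B16LeafFamily.not_uvBound01_of_torusLeaves`, revision v11; the
same count does NOT touch the bare-coupling reading, whose E₊(g₀) may grow like log g₀⁻¹).  The cross-run, cross-lattice
content of the PRINTED clauses is carried by the pin itself through [III] Cor. 3's *"independent of η and T"* for the
dependence FUNCTIONS e±(g_k) (`Cor3With`: e± chosen before the run).  Ordering on file: `UVBound01` ⇒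
`B16B10Shape.UVBound01Compact` ⇒ [with (2.6)] `UVBound01PerBare` ⇒ `UVBound01PerRun`, and `UVBound01` ⇒ `Cor3_250` ⇒
`UVBound01PerRun`; in toy models `B16B10Shape.UVBound01Compact` ⇏ `UVBound01PerBare` without (2.6)
(`B16PerBareCounter.compact_not_implies_perBare`) and `UVBound01PerRun` ⇏ `UVBound01PerBare`
(`B16PerBareCounter.perRun_not_implies_perBare`, even under the (2.6)-floor: `perRun_floor_not_implies_perBare`, revision v9),
while `B16B10Shape.UVBound01Compact` ⇒ `UVBound01PerRun` holds for every construction (`B16PerBareCounter.perRun_of_compact`,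
revision v9).  No analytic content. -/

/-- Monotonicity of the two-sided inequality in its exponent constants (given χ_k ≥ 0): enlarging E₋, E₊ preserves
`UVIneq`.  (Same statement as the sibling module's `B16B10Shape.uvIneq_mono`, which cannot be imported here.) [folklore] -/
theorem uvIneq_of_le (D : RunData) (k : ℕ) (V : D.Cfg k) {Em Ep Em' Ep' : ℝ}
    (hχ : 0 ≤ D.χ k V) (h : UVIneq D k V Em Ep) (hm : Em ≤ Em') (hp : Ep ≤ Ep') :
    UVIneq D k V Em' Ep' := by
  obtain ⟨hlow, hup⟩ := h
  have hvol : (0 : ℝ) ≤ (D.numSites k : ℝ) := Nat.cast_nonneg _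
  refine ⟨le_trans (mul_le_mul_of_nonneg_left (Real.exp_le_exp.mpr ?_) hχ) hlow,
    le_trans hup (Real.exp_le_exp.mpr ?_)⟩
  · have := mul_le_mul_of_nonneg_right hm hvol
    linarith
  · exact mul_le_mul_of_nonneg_right hp hvol

/-- **(0.1) PER RUN** (p. 356 [2] clause *"independent of k, T_η, U_k"* read inside one run, where it says "independent
of k, U_k" — T_η is fixed by the run, so that word is vacuous here; cell GAPS G-ref2-16 (a)): for every run of the
]0, γ]-family there are E₋, E₊ serving every k ≤ K and every configuration V.  The weakest reading on file (E± may depend on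
the run, i.e. on K, m and the couplings); cell REFEREE R19.1 / GAPS G-ref2-11 (c). [cite: Balaban1989LargeFieldII, (0.1) p.356] -/
def UVBound01PerRun (C : Construction) : Prop :=
  ∃ γ : ℝ, 0 < γ ∧ ∀ P : B12.RunParams, (C P).flow.InInterval γ P.K →
    ∃ Em Ep : ℝ, ∀ k, k ≤ P.K → ∀ V : (C P).Cfg k, UVIneq (C P) k V Em Ep

/-- [III] Cor. 3 ⇒ (0.1) per run: take E± = max_{k ≤ K} e±(g_k) (a finite maximum, `Finset.sup'` over `range (K+1)`);
needs only χ_k ≥ 0.  No boundedness of e± on ]0, γ] is used (contrast `uvBound01_of_cor3_bounded`). [folklore] -/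
theorem uvBound01PerRun_of_cor3 (C : Construction) (hsign : SignConventions C) (h : Cor3_250 C) :
    UVBound01PerRun C := by
  obtain ⟨γ, hγ, em, ep, hc⟩ := h
  refine ⟨γ, hγ, fun P hP => ?_⟩
  have hne : (Finset.range (P.K + 1)).Nonempty := Finset.nonempty_range_iff.mpr (Nat.succ_ne_zero _)
  refine ⟨(Finset.range (P.K + 1)).sup' hne (fun k => em ((C P).flow.g k)),
    (Finset.range (P.K + 1)).sup' hne (fun k => ep ((C P).flow.g k)), ?_⟩
  intro k hk V
  have hkmem : k ∈ Finset.range (P.K + 1) := Finset.mem_range.mpr (Nat.lt_succ_of_le hk)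
  exact uvIneq_of_le (C P) k V (hsign P k V) (hc P hP k hk V)
    (Finset.le_sup' (fun k => em ((C P).flow.g k)) hkmem)
    (Finset.le_sup' (fun k => ep ((C P).flow.g k)) hkmem)

/-- **The pin implies (0.1) per run** (given χ_k ≥ 0): `EndStatementBPrinted C → UVBound01PerRun C` — (0.1) read inside
one run ("independent of k, U_k").  The T_η-faithful bare-coupling reading `UVBound01PerBare` is NOT obtained this way —
and cannot be: `B16PerBareCounter.pin_not_implies_perBare`, and not even together with the (2.6)-floor for any β₀ > 0:
`B16PerBareCounter.pin_floor_not_implies_perBare_sharp` (cell FINAL-STATEMENT §6d(2), v8–v11; cell GAPS G-ref2-16 (a),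
G-ref2-19 (c), C-r2.27/28). [folklore] -/
theorem uvBound01PerRun_of_endStatementBPrinted (C : Construction) (hsign : SignConventions C)
    (h : EndStatementBPrinted C) : UVBound01PerRun C :=
  uvBound01PerRun_of_cor3 C hsign h.2

/-- The run-uniform reading trivially implies the per-run one (same constants for every run). [folklore] -/
theorem uvBound01PerRun_of_uvBound01 (C : Construction) (h : UVBound01 C) : UVBound01PerRun C := by
  obtain ⟨γ, hγ, Em, Ep, h⟩ := h
  exact ⟨γ, hγ, fun P hP => ⟨Em, Ep, fun k hk V => h P hP k hk V⟩⟩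

/-- The pin, unfolded to what it yields for (0.1) without any extra hypothesis: Theorem 1 ∧ (0.1)-per-run. [folklore] -/
theorem thm1_and_perRun_of_endStatementBPrinted (C : Construction) (hsign : SignConventions C)
    (h : EndStatementBPrinted C) : Thm1Printed C ∧ UVBound01PerRun C :=
  ⟨h.1, uvBound01PerRun_of_endStatementBPrinted C hsign h⟩

/-- **(0.1) PER BARE COUPLING** (revision v7; cell REFEREE R24.3 / GAPS G-ref2-16 (a)): the p. 356 [2] clause
*"independent of k, T_η, U_k"* read with E± depending ONLY on the bare coupling g₀ = g_0 of the run — one pair E₋, E₊ for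
every run of the ]0, γ]-family starting from g₀ (every K and m, hence every lattice T_η), every step k ≤ K and every
configuration.  The weakest reading in which all three printed words have content; strictly above `UVBound01PerRun` (which
it implies, `uvBound01PerRun_of_perBare`; not conversely, even under the (2.6)-floor:
`B16PerBareCounter.perRun_floor_not_implies_perBare`) and below `B16B10Shape.UVBound01Compact` UNDER (2.6) [III] (from which
it then follows — printed p. 255, UNPROVED in print, the cell's located step (i) `B14FlowStep` / `B14.FlowIneq26` —
`uvBound01PerBare_of_window_floor`, by name `B16B10Shape.uvPerBare_of_uvCompact_floor`; WITHOUT the floor the two are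
incomparable on toy carriers: `B16PerBareCounter.compact_not_implies_perBare` / `perBare_not_implies_compact`, revision v9),
hence CONDITIONAL on the interval hypothesis AND on (2.6); NOT derivable from the pin: kernel counter-models
`B16PerBareCounter.pin_not_implies_perBare`, `B16PerBareCounter.compact_not_implies_perBare` (M1),
`B16PerBareCounter.pin_floor_not_implies_perBare` (M2), `B16PerBareCounter.pin_floor_not_implies_perBare_sharp` (M5(β₀),
every β₀ > 0) (section docstring; revision v8, cell GAPS G-ref2-19 (c); v9, cell GAPS C-r2.27/28).  The bare
coupling of a run is
`(C P).flow.g 0`, as in `B16B10Shape.SmallCouplingsOccur` (the carrier does not tie it to `P.g0`).  A located reading,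
not a printed statement. [cite: Balaban1989LargeFieldII, (0.1) p.356] -/
def UVBound01PerBare (C : Construction) : Prop :=
  ∃ γ : ℝ, 0 < γ ∧ ∀ g₀ : ℝ, 0 < g₀ → g₀ ≤ γ → ∃ Em Ep : ℝ, ∀ P : B12.RunParams,
    (C P).flow.InInterval γ P.K → (C P).flow.g 0 = g₀ → ∀ k, k ≤ P.K → ∀ V : (C P).Cfg k, UVIneq (C P) k V Em Ep

/-- The run-uniform reading implies the bare-coupling one (the same constants for every g₀). [folklore] -/
theorem uvBound01PerBare_of_uvBound01 (C : Construction) (h : UVBound01 C) : UVBound01PerBare C := by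
  obtain ⟨γ, hγ, Em, Ep, h⟩ := h
  exact ⟨γ, hγ, fun g₀ _ _ => ⟨Em, Ep, fun P hP _ k hk V => h P hP k hk V⟩⟩

/-- The bare-coupling reading implies the per-run one: a run of the ]0, γ]-family has its bare coupling `g_0` in ]0, γ]
(the interval hypothesis at k = 0), and its own pair E±(g_0) serves it. [folklore] -/
theorem uvBound01PerRun_of_perBare (C : Construction) (h : UVBound01PerBare C) : UVBound01PerRun C := by
  obtain ⟨γ, hγ, h⟩ := h
  refine ⟨γ, hγ, fun P hP => ?_⟩
  obtain ⟨Em, Ep, hE⟩ := h ((C P).flow.g 0) (hP 0 (Nat.zero_le _)).1 (hP 0 (Nat.zero_le _)).2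
  exact ⟨Em, Ep, fun k hk V => hE P hP rfl k hk V⟩

/-- **The bare-coupling reading from the compact-window statement under the flow inequality (2.6) [III] (printed p. 255,
UNPROVED in print — a HYPOTHESIS here).**
`hwin`: for every window [g_min, γ], 0 < g_min ≤ γ, one pair E± serving every run of the ]0, γ]-family, every step with
g_min ≤ g_k and every configuration — literally `∀ g_min …, ∃ Em Ep, B16B10Shape.UV01Window C γ g_min Em Ep` unfolded (that
module imports this one; its `UVBound01Compact C` is `∃ γ > 0` of this hypothesis, so there the corollary
`UVBound01Compact C → (floor) → UVBound01PerBare C` is one line).  `hfloor`: the last member of (2.6) [III] p. 255 [13] at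
m = 0 — *"g_m ≤ (1+β₀) g_n , (2.6) where n > m, and β₀ > 0 can be chosen arbitrarily small, if g is sufficiently small."*
(typed for whole flows as `B14.FlowIneq26`, second conjunct) — i.e. g_0 ≤ (1+β₀) g_k for k ≤ K, β₀ ≥ 0 (k = 0 is trivial);
p. 255 continues *"The inequalities follow from the renormalization group equations (0.20) [I], and from the properties of
the β-functions."* and no proof is printed — the cell's located UNPROVED-IN-PRINT step (i) (`B14FlowStep`; cell
`MISSING-B14.md`; revision v8, cell GAPS G-ref2-19 (c)), so `hfloor` is a genuine hypothesis, and a load-bearing one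
(`B16PerBareCounter.m1_floor_fails`: a toy construction satisfying `hwin` and violating the conclusion, hence the floor).
Then a run from g₀ stays in the window [g₀/(1+β₀), γ], whose pair E± serves it.  Bookkeeping. [cite: Balaban1988Convergent, (2.6) p.255] -/
theorem uvBound01PerBare_of_window_floor (C : Construction) (γ : ℝ) (hγ : 0 < γ) (β₀ : ℝ) (hβ₀ : 0 ≤ β₀)
    (hwin : ∀ gmin : ℝ, 0 < gmin → gmin ≤ γ → ∃ Em Ep : ℝ, ∀ P : B12.RunParams, (C P).flow.InInterval γ P.K →
      ∀ k, k ≤ P.K → gmin ≤ (C P).flow.g k → ∀ V : (C P).Cfg k, UVIneq (C P) k V Em Ep)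
    (hfloor : ∀ P : B12.RunParams, (C P).flow.InInterval γ P.K →
      ∀ k, k ≤ P.K → (C P).flow.g 0 ≤ (1 + β₀) * (C P).flow.g k) :
    UVBound01PerBare C := by
  refine ⟨γ, hγ, fun g₀ hg₀ hg₀γ => ?_⟩
  have hpos : (0 : ℝ) < 1 + β₀ := by linarith
  have hmin : 0 < g₀ / (1 + β₀) := div_pos hg₀ hpos
  have hminle : g₀ / (1 + β₀) ≤ γ := le_trans (div_le_self hg₀.le (by linarith)) hg₀γ
  obtain ⟨Em, Ep, hE⟩ := hwin (g₀ / (1 + β₀)) hmin hminle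
  refine ⟨Em, Ep, fun P hP hg0 k hk V => hE P hP k hk ?_ V⟩
  have hfk : g₀ ≤ (1 + β₀) * (C P).flow.g k := by
    rw [← hg0]
    exact hfloor P hP k hk
  rw [div_le_iff₀ hpos]
  linarith

/-- The same from [III] Cor. 3's form directly: `Cor3With C γ em ep` with e± bounded above on every coupling window
[g_min, γ], g_min > 0 (local boundedness on ]0, γ]; e.g. from `ContinuousOn` on `Set.Ioc 0 γ`, cf.
`B16B10Shape.uvCompact_of_cor3_continuousOn_Ioc`), the (2.6)-floor and χ_k ≥ 0 give the bare-coupling reading.  In words: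
"pin + local boundedness of e± + (2.6)", each of the two additions load-bearing (revision v8, cell GAPS G-ref2-19 (c):
`B16PerBareCounter.m2_no_locally_bounded_witness` — pin + (2.6)-floor without local boundedness fails;
`B16PerBareCounter.m1_floor_fails` — pin + local boundedness without the floor fails) — contrast
`endStatementB_of_printed_bounded` ("pin + boundedness on all of ]0, γ]" ⇒ the run-uniform reading) and
`uvBound01PerRun_of_cor3` (pin alone ⇒ per run). [folklore] -/
theorem uvBound01PerBare_of_cor3_floor (C : Construction) (hsign : SignConventions C) (γ : ℝ) (hγ : 0 < γ)
    (em ep : ℝ → ℝ) (hcor : Cor3With C γ em ep)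
    (hbdd : ∀ gmin : ℝ, 0 < gmin → gmin ≤ γ →
      (∃ Em : ℝ, ∀ x, gmin ≤ x → x ≤ γ → em x ≤ Em) ∧ (∃ Ep : ℝ, ∀ x, gmin ≤ x → x ≤ γ → ep x ≤ Ep))
    (β₀ : ℝ) (hβ₀ : 0 ≤ β₀)
    (hfloor : ∀ P : B12.RunParams, (C P).flow.InInterval γ P.K →
      ∀ k, k ≤ P.K → (C P).flow.g 0 ≤ (1 + β₀) * (C P).flow.g k) :
    UVBound01PerBare C := by
  refine uvBound01PerBare_of_window_floor C γ hγ β₀ hβ₀ (fun gmin hmin hle => ?_) hfloor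
  obtain ⟨⟨Em, hEm⟩, ⟨Ep, hEp⟩⟩ := hbdd gmin hmin hle
  refine ⟨Em, Ep, fun P hP k hk hgk V => ?_⟩
  exact uvIneq_of_le (C P) k V (hsign P k V) (hcor P hP k hk V)
    (hEm _ hgk (hP k hk).2) (hEp _ hgk (hP k hk).2)

/-! ## Section 1 of the paper (pp. 356–392 [2–38]) — phase-2 typing (cell row P16; seat `b2b-balaban-b02`)

The body of the paper is ONE section, *"1. The Conclusion of the Operation 𝐑 — Localization, Bounds, and Exponentiation"*,
formulas (1.1)–(1.104); there are no §§2–3.  Its reference list (p. 392 [38]) has four items [I]–[IV] = B12, B13, B14, B15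
([Balaban1987RG1], [Balaban1988RG2Cluster], [Balaban1988Convergent], [Balaban1989LargeFieldI]); every numeric citation
"[n]" in the text is entry n of [I]'s list ("[16]" = [Balaban1985UV3] = B10, "[15]" = [Balaban1985Variational] = B11,
"[26]" = Cammarota, CMP 85 (1982)), and "(7.1) [I]", "(7.13) [I]" are (2.1), (2.13) of [II] (cell DIVERGENCE D-T1b,
D-b02.1).  WHAT IS TYPED HERE, and how (cell DIVERGENCE D-b02.8, "schematic typing"): (a) the displayed inequalities with
which the proof of Theorem 1 CONCLUDES — (1.68)–(1.69) p. 377 (bounds of the localized terms: decay RELATIVE to the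
large-field region), (1.97) p. 389–390, (1.99), (1.100) p. 390 (activity and new-term bounds) — as `Prop`s over the
abstract localization-domain carrier `RelDomainSys` = `LocDomainSys` + the relative size `d_{k,Z}` of (1.67); the
fundamental inequality (1.89) p. 387 is `Step.FundIneq189` and its derivation from the budget (1.79)–(1.88) is
`Step.Budget.fundIneq189_of_budget` (not repeated); (b) the elementary kernels the text uses without proof: the
complex-exponential inequality behind (1.73)–(1.75) p. 380 (`exp_neg_le_cos`, `exp_neg_two_norm_le_re_cexp`, `ineq173`,
`ineq174`, `ineq175`; the bound `s` on σ is a HYPOTHESIS throughout — print p. 379 derives it for the quadratic-form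
half σ_Q, the V(X~) half being the cell's OPEN objection G-adv3-21), the `β₀ = 1/7` exponent budget of p. 389
(`budget_beta0_iff`, `budget_beta0_le`), the absorption (1.99) ⇒ (1.100) (`ineq1100_of_199` with the O(1) kept;
`ineq1100_of_199_floor`, revision v12: exactly (1.100) under an explicit floor `d₀ ≤ d_k(X)` on the second group and
`O(1) ≤ exp(½βκd₀)` — cell DIVERGENCE D-b02.7; `ineq1100_of_199_adm`, revision v13: the same with the floor scoped as
printed, p. 390 — floor OR vanishing term), the passage
(1.100) ⇒ (2.31) [III] at the newest scale (p. 390; `boundR231_of_ineq1100`, `lfBoundR_new_of_ineq1100` — exactly the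
`boundR` clause of `Step.LFHypImproved`, composing with `Step.exp_neg_p0Profile_le_pow`; order of constants "κ₀ before
γ"), the norm bookkeeping of p. 359 (`prop1_chain_M7`: along the printed chain the exponent of `M` in (1.78) [IV] is 7, not
5; cell GAPS G-B16-02 — immaterial downstream), and the fact that a bound with decay RELATIVE to the large-field region
((1.99); = the "other possible form of the inductive assumptions" of [III] p. 262) does not imply the printed full-decay
hypothesis (2.42) [III] (`relBound_of_fullBound`, `relDecay_not_fullDecay`; cell GAPS G-B16-10); (c) the proof
STRUCTURE of Theorem 1 exactly as the paper states it — induction on k ([III] Thm 1 p. 262: "ρ₀ = exp[−(1/g₀²)A − E]";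
p. 390–391 here: "This new action satisfies the induction hypothesis … This completes the proof of Theorem 1") —
kernel-checked as `thm1_of_steps`; (d) the exact extra clause under which [III] Cor. 3 yields (0.1) with k-independent
constants (`uvBound01_of_cor3_continuousOn`; cell GAPS G-B16-08 (d)).  NOT typed: the functional integrals (1.1)–(1.72),
the four-stage localization (1.58)–(1.66), the polymer expansion (1.90)–(1.96) — carried by the abstract predicate
`RunData.Sect2Form` as before (STATUS, revision v12: the paper-internal bookkeeping of pp. 387–390 is kernel-checked
DOWNSTREAM of this module, over the quoted leaves `Ineq197`/`Ineq199` below and importing nothing back here — (1.97) ⇒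
(1.98)–(1.99) from the hub tree's Kotecký–Preiss theorem with the two-footprint "proper notational changes" in the sibling
module `B16Exp198` (`Geometry.ineq199_of_ineq197`; cell GAPS C-B16-16), and (1.92), (1.93), (1.94), (1.96) + the five
smallness clauses of pp. 388–389 ⇒ (1.97) over a one-polymer schematic carrier in the sibling module `B16Ineq197`
(`ineq197_of_leaves`; cell GAPS C-b02g14-1); the Mayer step (1.90)–(1.91) itself and the lattice instances of that
module's leaves remain untyped); their line-by-line reading is the cell transcript `HOME/b2b-balaban-b02/B16-transcript.md`
(38/38 pp.) with GAPS rows G-B16-01…12 (objections/readings/adjudications) and C-B16-1…10 (certifications/answers).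
(e) NOT typed and NOT relied on: the "final remark" pp. 391–392 — (1.103), the second exponentiation of its square
bracket, and the representation (1.104) with multiplication operations `𝐓′_k(Y_i)1` (*"The representation (1.104) can be
used alternatively in the inductive description of the effective actions, and the above considerations leading to it
give the proof of Theorem 1"*, p. 392).  Its convergence is justified in print only by *"looking carefully at a standard
proof of the convergence of the expansion (e.g., in [26]), we see that in the present situation such factors are not
needed, because there are no summations over these domains, they are fixed"* (p. 391); the cell's adjudication GAPS
G-B16-11 (gen 2, upholding the objection G-adv3-4 and downgrading the gen-1 certification C-B16-8 to the algebraic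
identity (1.103) + substitution list) records why this does not suffice: with the normalized operations
`(𝐓′_k(Y_i)1)⁻¹𝐓′_k(Y_i)` INSIDE the bracket the polymers of the second expansion that contain a fixed erased component
`Y_i` are pairwise incompatible, so absolute convergence needs their total activity `S_i < 1`, while the printed activity
bound gives only `S_i ≲ N_∂(Y_i)·O(1)α^{1/3}` with `N_∂(Y_i) ≥ 2d(40R_k)^{d−1}` boundary M-cubes and `α` a k-independent
constant ((1.68) p. 377) — no printed restriction makes this `< 1` uniformly in `R_k ≥ (log g_k^{−2})^r`.  Theorem 1 /
Cor. 3 as printed are unaffected (their proof is the (1.72) + (1.98) representation and closes at p. 391 ll. 1–2); only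
the "used alternatively" sentence is not established (cell DIVERGENCE D-b02.9).  Value: typed skeleton + kernel
arithmetic, NOT summit progress. -/

/-! ### 1a. Elementary kernels used without proof in §1 -/

/-- `e^{−t} ≤ cos t` on `[0,1]` — the real inequality behind (1.74) p. 380 [26]: combined with `e^{Re σ} ≥ e^{−|σ|}` it
gives `Re e^{σ} ≥ e^{−2|σ|}` for `|σ| ≤ 1`.  Proof: `e^{−t} ≤ 1/(1+t) ≤ 1 − t²/2 ≤ cos t`. [folklore] -/
theorem exp_neg_le_cos {t : ℝ} (h0 : 0 ≤ t) (h1 : t ≤ 1) : Real.exp (-t) ≤ Real.cos t := by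
  have hcos : 1 - t ^ 2 / 2 ≤ Real.cos t := Real.one_sub_sq_div_two_le_cos
  have hpos : (0 : ℝ) < 1 + t := by linarith
  have hexp : Real.exp (-t) ≤ 1 / (1 + t) := by
    rw [le_div_iff₀ hpos]
    have h := Real.add_one_le_exp t
    calc Real.exp (-t) * (1 + t) ≤ Real.exp (-t) * Real.exp t :=
          mul_le_mul_of_nonneg_left (by linarith) (Real.exp_pos _).le
      _ = 1 := by rw [← Real.exp_add]; simp
  have hmid : 1 / (1 + t) ≤ 1 - t ^ 2 / 2 := by
    rw [div_le_iff₀ hpos]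
    nlinarith [mul_nonneg (mul_nonneg h0 (sub_nonneg.mpr h1)) (by linarith : (0 : ℝ) ≤ 2 + t)]
  exact hexp.trans (hmid.trans hcos)

/-- (1.74) p. 380 [26], the pointwise kernel: for a complex `σ` with `‖σ‖ ≤ 1`, `Re e^{σ} ≥ e^{−2‖σ‖}` — the text: *"|𝐓′_k(X,
(𝐔,𝐉))1| = |𝐓′_k(X,(𝐔,0)) e^{σ}| ≥ 𝐓′_k(X,(𝐔,0)) e^{−2|σ|} ≥ (𝐓′_k(X,(𝐔,0))1) e^{−2 sup|σ|}"*, valid because 𝐓′_k(X,(𝐔,0))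
is a positive functional and `sup|σ| ≤ 1` by the smallness stated after (1.73) (`Re e^{σ} = e^{Re σ}cos(Im σ)`, and `cos`
needs `|Im σ| ≤ 1 < π/2`). [cite: Balaban1989LargeFieldII, (1.74) p.380] -/
theorem exp_neg_two_norm_le_re_cexp (σ : ℂ) (hσ : ‖σ‖ ≤ 1) :
    Real.exp (-(2 * ‖σ‖)) ≤ (Complex.exp σ).re := by
  rw [Complex.exp_re]
  have hre : |σ.re| ≤ ‖σ‖ := Complex.abs_re_le_norm σ
  have him : |σ.im| ≤ ‖σ‖ := Complex.abs_im_le_norm σ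
  have h1 : Real.exp (-‖σ‖) ≤ Real.exp σ.re :=
    Real.exp_le_exp.mpr (by have := neg_abs_le σ.re; linarith)
  have h2 : Real.exp (-‖σ‖) ≤ Real.cos σ.im := by
    have hc : Real.exp (-|σ.im|) ≤ Real.cos |σ.im| := exp_neg_le_cos (abs_nonneg _) (him.trans hσ)
    rw [Real.cos_abs] at hc
    exact (Real.exp_le_exp.mpr (by linarith)).trans hc
  have h12 : Real.exp (-(2 * ‖σ‖)) = Real.exp (-‖σ‖) * Real.exp (-‖σ‖) := by
    rw [← Real.exp_add]; ring_nf
  rw [h12]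
  exact mul_le_mul h1 h2 (Real.exp_pos _).le ((Real.exp_pos _).le.trans h1)

/-- (1.73) p. 380 [26] over a finite positive functional — the paper's `𝐓′_k(X,(𝐔,0))F` is an integral of `F` against a
positive density ("the exponential density in the integral is positive"), typed as a finite weighted sum `Σ_ω w_ω F(ω)`,
`w ≥ 0`; its analytic extension is `𝐓′_k(X,(𝐔,𝐉))F = 𝐓′_k(X,(𝐔,0))(e^{σ}F)` with `sup|σ| ≤ s`: *"|𝐓′_k(X,(𝐔,𝐉))F| =
|𝐓′_k(X,(𝐔,0)) e^{σ}F| ≤ 𝐓′_k(X,(𝐔,0))|e^{σ}F| ≤ (𝐓′_k(X,(𝐔,0))1) sup e^{|σ|}|F|"*.  ON THE BOUND `s` (revision v12,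
answering the cell's «ASK (b02)» of GAPS G-adv3-21): `s` is a HYPOTHESIS here and in `ineq174`/`ineq175` (and the
parameter `Consts.s` of the sibling module `B16Ineq197`, where (1.92)'s printed "+1" = `s` enters only the budget clause
of p. 389); print p. 379 [25] DERIVES a g_k-small bound for the quadratic-form half σ_Q of σ (*"the first order term can
be bounded by O(1)B₃²A₁²p₁²(g_k)|B₀|(α_{0,k}+α_{1,k}) < O(1)B₃²A₁²C₀M^dR_k^{d+2}p₁²(g_k)q₀(g_k)g_k, and this bound is
small"*; cell GAPS C-B16-5 restricted to σ_Q, C-adv7-18, SMALLNESS S-B16.9/S-B16.19) and ASSERTS it for the V(X~) half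
(*"The resummed expression has the same bound as above, with a different constant O(1)"*) — the latter is the cell's
OPEN objection G-adv3-21 (located unprinted derivative estimate; kernel witness `B16SigmaCauchy.lean` of unit adv3 that
sup bounds + the printed analyticity radii give no factor g_k); nothing below uses `s ≤ 1` except as the stated
hypothesis `hs` of `ineq174`. [cite: Balaban1989LargeFieldII, (1.73) p.380] -/
theorem ineq173 {Ω : Type*} (S : Finset Ω) (w : Ω → ℝ) (σ F : Ω → ℂ) (s Fsup : ℝ)
    (hw : ∀ ω ∈ S, 0 ≤ w ω) (hσ : ∀ ω ∈ S, ‖σ ω‖ ≤ s) (hF : ∀ ω ∈ S, ‖F ω‖ ≤ Fsup) :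
    ‖∑ ω ∈ S, w ω • (Complex.exp (σ ω) * F ω)‖ ≤ (∑ ω ∈ S, w ω) * Real.exp s * Fsup := by
  calc ‖∑ ω ∈ S, w ω • (Complex.exp (σ ω) * F ω)‖
      ≤ ∑ ω ∈ S, ‖w ω • (Complex.exp (σ ω) * F ω)‖ := norm_sum_le _ _
    _ ≤ ∑ ω ∈ S, w ω * (Real.exp s * Fsup) := by
        apply Finset.sum_le_sum
        intro ω hω
        rw [norm_smul, Real.norm_of_nonneg (hw ω hω), norm_mul, Complex.norm_exp]
        apply mul_le_mul_of_nonneg_left _ (hw ω hω)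
        exact mul_le_mul
          (Real.exp_le_exp.mpr ((Complex.re_le_norm _).trans (hσ ω hω)))
          (hF ω hω) (norm_nonneg _) (Real.exp_pos _).le
    _ = (∑ ω ∈ S, w ω) * Real.exp s * Fsup := by rw [← Finset.sum_mul]; ring

/-- (1.74) p. 380 [26] over the same finite positive functional: *"|𝐓′_k(X,(𝐔,𝐉))1| ≥ (𝐓′_k(X,(𝐔,0))1) e^{−2 sup|σ|}"* for
`sup|σ| ≤ s ≤ 1` — hence `𝐓′_k(X,(𝐔,𝐉))1 ≠ 0` whenever `𝐓′_k(X,(𝐔,0))1 > 0` ("obviously positive, although it may be very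
small").  The strict positivity itself is NOT typed (here and in `ineq175` it is the hypothesis `0 < T1` / the sign data
`hw`): it presupposes a real configuration `𝐔` in the interior of the integration domain of (1.71), i.e. the membership
statement that [IV] p. 195 defers — *"We do not show the above statement now, because we will need a stronger statement in
the future"* — and that no locus of the present paper supplies (pp. 358–359 take the domain of `χ_kχ_{k,Λ}` as hypothesis,
p. 361 uses (1.80) [IV] without proof): cell GAPS G-B15-03, G-B16-12, G-adv3-2a (located unprinted domain lemma; not an
error in (1.73)–(1.75)). [cite: Balaban1989LargeFieldII, (1.74) p.380] -/
theorem ineq174 {Ω : Type*} (S : Finset Ω) (w : Ω → ℝ) (σ : Ω → ℂ) (s : ℝ)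
    (hw : ∀ ω ∈ S, 0 ≤ w ω) (hσ : ∀ ω ∈ S, ‖σ ω‖ ≤ s) (hs : s ≤ 1) :
    (∑ ω ∈ S, w ω) * Real.exp (-(2 * s)) ≤ ‖∑ ω ∈ S, w ω • Complex.exp (σ ω)‖ := by
  have hre : (∑ ω ∈ S, w ω • Complex.exp (σ ω)).re = ∑ ω ∈ S, w ω * (Complex.exp (σ ω)).re := by
    rw [Complex.re_sum]
    refine Finset.sum_congr rfl fun ω _ => ?_
    rw [Complex.smul_re, smul_eq_mul]
  calc (∑ ω ∈ S, w ω) * Real.exp (-(2 * s)) = ∑ ω ∈ S, w ω * Real.exp (-(2 * s)) := Finset.sum_mul _ _ _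
    _ ≤ ∑ ω ∈ S, w ω * (Complex.exp (σ ω)).re := by
        apply Finset.sum_le_sum
        intro ω hω
        apply mul_le_mul_of_nonneg_left _ (hw ω hω)
        have h1 : ‖σ ω‖ ≤ 1 := (hσ ω hω).trans hs
        exact (Real.exp_le_exp.mpr (by linarith [hσ ω hω])).trans (exp_neg_two_norm_le_re_cexp (σ ω) h1)
    _ = (∑ ω ∈ S, w ω • Complex.exp (σ ω)).re := hre.symm
    _ ≤ ‖∑ ω ∈ S, w ω • Complex.exp (σ ω)‖ := Complex.re_le_norm _

/-- (1.75) p. 380 [26] as real arithmetic: from (1.73) (`num ≤ T1·e^{s}·sup|F|`) and (1.74) (`den ≥ T1·e^{−2s}`) with `T1 =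
𝐓′_k(X,(𝐔,0))1 > 0`: *"|(𝐓′_k(X,(𝐔,𝐉))1)^{−1} 𝐓′_k(X,(𝐔,𝐉))F| ≤ e^{3 sup|σ|} sup|F|"*. [cite: Balaban1989LargeFieldII, (1.75) p.380] -/
theorem ineq175 (T1 s Fsup num den : ℝ) (hT : 0 < T1) (hF : 0 ≤ Fsup)
    (h73 : num ≤ T1 * Real.exp s * Fsup) (h74 : T1 * Real.exp (-(2 * s)) ≤ den) :
    num / den ≤ Real.exp (3 * s) * Fsup := by
  have hden : 0 < den := lt_of_lt_of_le (mul_pos hT (Real.exp_pos _)) h74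
  rw [div_le_iff₀ hden]
  have key : T1 * Real.exp s * Fsup = Real.exp (3 * s) * Fsup * (T1 * Real.exp (-(2 * s))) := by
    have : Real.exp s = Real.exp (3 * s) * Real.exp (-(2 * s)) := by rw [← Real.exp_add]; ring_nf
    rw [this]; ring
  calc num ≤ T1 * Real.exp s * Fsup := h73
    _ = Real.exp (3 * s) * Fsup * (T1 * Real.exp (-(2 * s))) := key
    _ ≤ Real.exp (3 * s) * Fsup * den := mul_le_mul_of_nonneg_left h74 (mul_nonneg (Real.exp_pos _).le hF)

/-- p. 389 [35], the choice `β₀ = 1/7`, verbatim (render p035): *"We assume that g_k is so small that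
−2(1+β₀)⁻¹p₀(g_k) + 1 + 2κ(100R_k)^d ≤ −(3/2)p₀(g_k) (for example, take β₀ = 1/7, then this means that
−(1/4)p₀(g_k) + 1 + 2κ(100R_k)^d ≤ 0, and before we had stronger restrictions on p₀(g_k))."* — exact arithmetic: with
`β₀ = 1/7` the coefficient is `7/4` and the exponent inequality is EQUIVALENT to `1 + 2κ(100R_k)^d ≤ ¼p₀(g_k)` — this
theorem CONFIRMS the printed parenthesis (cell GAPS G-pv13-3) — a g_k-smallness condition which needs `p₀ > d·r₀` (cell
GAPS G-B16-07, R9). [cite: Balaban1989LargeFieldII, p.389] -/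
theorem budget_beta0_iff (p c : ℝ) :
    -(2 * (1 + (1 / 7 : ℝ))⁻¹) * p + 1 + c ≤ -(3 / 2) * p ↔ 1 + c ≤ p / 4 := by
  have h74 : (2 * (1 + (1 / 7 : ℝ))⁻¹) = 7 / 4 := by norm_num
  rw [h74]
  constructor <;> intro h <;> linarith

/-- p. 389 [35], general form: for any `0 ≤ β₀ ≤ 1/7` and `p₀(g_k) ≥ 0` the same smallness condition `1 + 2κ(100R_k)^d ≤
¼p₀(g_k)` gives `−2(1+β₀)⁻¹p₀(g_k) + 1 + 2κ(100R_k)^d ≤ −(3/2)p₀(g_k)` (so "β₀ = 1/7" is the largest admissible example). [cite: Balaban1989LargeFieldII, p.389] -/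
theorem budget_beta0_le (β₀ p c : ℝ) (h0 : 0 ≤ β₀) (h7 : β₀ ≤ 1 / 7) (hp : 0 ≤ p) (h : 1 + c ≤ p / 4) :
    -(2 * (1 + β₀)⁻¹) * p + 1 + c ≤ -(3 / 2) * p := by
  have hpos : (0 : ℝ) < 1 + β₀ := by linarith
  have hcoef : 7 / 4 ≤ 2 * (1 + β₀)⁻¹ := by
    rw [← div_eq_mul_inv, le_div_iff₀ hpos]; linarith
  nlinarith [mul_le_mul_of_nonneg_right hcoef hp]

/-- p. 359 [5] ll. 12–25 (the proof of Prop. 1 [IV]), norm bookkeeping (cell GAPS G-B16-02): the inverse bound `γ₀⁻¹·2d(100M)⁵`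
of the operator `P₀H*_{1,k}Δ₁(ζ₀)H_{1,k}P₀` comes from the quadratic-form bound (1.9), i.e. it is an ℓ² → ℓ² bound, while
(1.78) [IV] is POINTWISE.  Along the printed chain `sup|B′| ≤ ‖B′‖₂ ≤ ‖T⁻¹‖·‖P₀H*J‖₂ ≤ γ₀⁻¹2d(100M)⁵ · (d(100M)⁴)^{1/2} ·
4B₃ε` the honest constant is `8 d^{3/2} γ₀⁻¹ B₃ (100M)⁷ ε`: the exponent of `M` is 7, not the printed 5 — immaterial
downstream (every use is `c(M)·ε_k → 0` at fixed `M`; [IV] p. 195: "The power M⁵ is not the optimal one, in fact we can take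
just M, but we will not prove it"). [cite: Balaban1989LargeFieldII, p.359] -/
theorem prop1_chain_M7 (d M γ₀ B₃ ε : ℝ) (hd : 0 ≤ d) :
    (2 * d * (100 * M) ^ 5 / γ₀) * Real.sqrt (d * (100 * M) ^ 4) * (4 * B₃ * ε)
      = 8 * d * Real.sqrt d * (100 * M) ^ 7 * B₃ * ε / γ₀ := by
  have h4 : Real.sqrt (d * (100 * M) ^ 4) = Real.sqrt d * (100 * M) ^ 2 := by
    rw [Real.sqrt_mul hd, show (100 * M) ^ 4 = ((100 * M) ^ 2) ^ 2 by ring, Real.sqrt_sq (by positivity)]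
  rw [h4]; ring

/-- Cell GAPS G-B16-10 (B), first half: a bound with tree decay in the FULL size `d_k(X)` ((2.42) [III] as printed;
`Step.LFHyp.boundB`) implies the same bound with any smaller RELATIVE size `d_{k,Z}(X) ≤ d_k(X)` ((1.67); the form (1.99)
delivers, = "(2.42) with d_j(X) replaced by d_j(X∖Z_j)" of [III] p. 262), for `κ ≥ 0`, `B₀ ≥ 0`. [folklore] -/
theorem relBound_of_fullBound {κ B₀ dFull dRel b : ℝ} (hκ : 0 ≤ κ) (hB : 0 ≤ B₀) (hd : dRel ≤ dFull)
    (h : b ≤ B₀ * Real.exp (-κ * dFull)) : b ≤ B₀ * Real.exp (-κ * dRel) :=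
  h.trans (mul_le_mul_of_nonneg_left (Real.exp_le_exp.mpr (by nlinarith [mul_le_mul_of_nonneg_left hd hκ])) hB)

/-- Cell GAPS G-B16-10 (B), second half: … and NOT conversely — a relative-decay bound does not give the printed full-decay
hypothesis (2.42) [III] (witness: `κ = B₀ = d_k(X) = b = 1`, `d_{k,Z}(X) = 0`, i.e. a domain glued to a large-field
component).  This is the precise sense in which the series closes its induction on the boundary terms only through [III]
p. 262, ll. 6–15: "we obtain the bound (2.42) with d_j(X) replaced by d_j(X∖Z_j). All constructions and proofs of the
procedure can be carried on with these inductive assumptions." [folklore] -/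
theorem relDecay_not_fullDecay :
    ∃ κ B₀ dFull dRel b : ℝ, 0 ≤ κ ∧ 0 ≤ B₀ ∧ 0 ≤ dRel ∧ dRel ≤ dFull ∧
      b ≤ B₀ * Real.exp (-κ * dRel) ∧ ¬ b ≤ B₀ * Real.exp (-κ * dFull) := by
  refine ⟨1, 1, 1, 0, 1, by norm_num, by norm_num, le_rfl, by norm_num, by simp, ?_⟩
  have : Real.exp (-1 * 1) < 1 := Real.exp_lt_one_iff.mpr (by norm_num)
  intro h
  linarith

/-! ### 1b. The localization-domain carrier of §1 — full and relative tree sizes ((1.67) p. 376) -/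

/-- The system of localization domains of the k-th step as §1 uses it: `LocDomainSys` (domains `X ∈ 𝐃_k`, full tree size
`d_k(X) ≥ 0`, [I] p. 257) EXTENDED by the RELATIVE size of (1.67) p. 376 [22], verbatim (render p022): *"Introduce the
following definition of the relative linear size d_{k,Z}(Y) of a domain Y ∈ 𝐃_k: d_{k,Z}(Y) = M⁻¹ (the length of a
shortest tree graph contained in Y and intersecting all M-cubes of the components of Y∖Z). (1.67)"* — taken here relative
to the erased class-2 components, `dRel` = the `d_{k,∪Y_i}` of (1.95)–(1.99), with `0 ≤ d_{k,Z}(X) ≤ d_k(X)` (a tree meeting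
all cubes of X meets those of X∖Z).  The predicate `MeetsLF X`: its INTENDED instantiation is the printed selector of the
constant `c₁` in (1.97) (p. 390 l. 1: *"c₁ = exp(−p₀(g_k)) if X′ does not intersect ⋃_{i=1}^m Y_i, and c₁ = α^{1/3} in the
remaining cases"*), i.e. `MeetsLF X` = "X ∩ ⋃_i Y_i ≠ ∅"; under it `Ineq197`/`Ineq199` are literal and
`dRel_eq_of_not_meets` is (1.67) itself (for X ∩ ⋃_i Y_i = ∅ every M-cube of X counts, so `d_{k,∪Y_i}(X) = d_k(X)`).  The
paper's OTHER dichotomy — p. 390: *"To the first group we assign all the terms with the localization domains X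
intersecting the large field region Z_k^~ ∪ ⋃_{i=1}^m Y_i^~, to the second group the terms with the domains disjoint with
this region. The terms of the first group are new boundary terms, and they are denoted by 𝐁′^{(k)}(X)."* — names the
terms and is NOT the c₁-selector: a domain meeting only a collar `Y_i^~∖Y_i` or `Z_k^~` is a boundary term by name but has
`c₁ = exp(−p₀(g_k))`; gen 1's docstring read `MeetsLF` as that naming split, under which the weak branches of
`Ineq197`/`Ineq199` are print-implied only given `exp(−p₀(g_k)) ≤ α^{1/3}` (cell GAPS G-pv13-3 (c), DIVERGENCE D-b02.11;
no statement changed — `MeetsLF` is abstract data and both instantiations type-check every theorem here and in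
`B14RelBoundary`).  Cube geometry abstracted (cell DIVERGENCE D-b02.8). [cite: Balaban1989LargeFieldII, (1.67) p.376] -/
structure RelDomainSys extends LocDomainSys where
  dRel : Dom → ℝ
  MeetsLF : Dom → Prop
  dRel_nonneg : ∀ X, 0 ≤ dRel X
  dRel_le : ∀ X, dRel X ≤ dj X
  dRel_eq_of_not_meets : ∀ X, ¬ MeetsLF X → dRel X = dj X

/-! ### 1c. The displayed bounds with which the proof of Theorem 1 concludes (pp. 377–390), as quoted leaves -/

/-- **(1.68)** p. 377 [23], verbatim (render p023): *"|V(Y,(𝐔,𝐉))| ≤ α exp(−(1+2β)κ d_{k,Z}(Y)) (1.68) for Y∖Z^~ ≠ ∅, with a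
constant α, which can be chosen arbitrarily small for γ small enough"* — the resummed localized terms of the fluctuation
integral (p. 377: *"The expression corresponding to such a domain Y depends on the new background field U_k restricted to
Y, and also on the fields A, B, V″ localized in Y. We denote this expression by V(Y, U_k). It has an analytic extension
V(Y,(𝐔,𝐉)) defined on the space Ũ^c_k(Y, α̃₀, α̃₁), and satisfying the bounds:"*); `inside Y` = "Y is a component of
Z^~" (then (1.69) applies instead).  NB `α` is a k-INDEPENDENT constant fixed by `γ` (this is the constant of cell GAPS
G-B16-11 (iii)).  Decay is in the RELATIVE size (cell GAPS G-B16-05). [cite: Balaban1989LargeFieldII, (1.68) p.377] -/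
def Ineq168 (S : RelDomainSys) (inside : S.Dom → Prop) {Φ : Type*} (dom : S.Dom → Set Φ) (V : S.Dom → Φ → ℂ)
    (α β κ : ℝ) : Prop :=
  ∀ Y, ¬ inside Y → ∀ φ ∈ dom Y, ‖V Y φ‖ ≤ α * Real.exp (-((1 + 2 * β) * κ) * S.dRel Y)

/-- **(1.69)** p. 377 [23], verbatim (render p023): *"|V(Y,(𝐔,𝐉))| ≤ O(1) Σ_{j=1}^{k} |Γ_j^0 ∩ Y|, (1.69) if Y is a component of
Z^~. Here {Γ_j^0} denotes the old determining set, obtained after the last renormalization transformation, with which we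
have started the analysis in Sect. [IV]."* — a VOLUME bound, no decay (the source of the `E_±|T_η|`-size constants of
(0.1)); `lfCubes Y` = `Σ_j |Γ_j^0 ∩ Y|`, `C` = the O(1). [cite: Balaban1989LargeFieldII, (1.69) p.377] -/
def Ineq169 (S : RelDomainSys) (inside : S.Dom → Prop) {Φ : Type*} (dom : S.Dom → Set Φ) (V : S.Dom → Φ → ℂ)
    (lfCubes : S.Dom → ℕ) (C : ℝ) : Prop :=
  ∀ Y, inside Y → ∀ φ ∈ dom Y, ‖V Y φ‖ ≤ C * (lfCubes Y : ℝ)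

/-- **(1.97)** p. 389–390 [35–36], verbatim (renders p035/p036): *"|F(X′)| ≤ c₁ exp(−(1+β)κ d_{k,∪Y_i}(X′)), (1.97) where c₁ =
exp(−p₀(g_k)) if X′ does not intersect ⋃_{i=1}^m Y_i, and c₁ = α^{1/3} in the remaining cases."* — the final bound of the
polymer activities (1.91) of the exponentiated cluster expansion of the curly bracket in (1.72); `p0val` = `p₀(g_k)` (=
`p0Profile A₀ p₀ g_k`); `S.MeetsLF X` read as "X ∩ ⋃_i Y_i ≠ ∅" (see `RelDomainSys`).  p. 390: *"The estimate (1.97) is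
sufficient for convergence of the exponentiated cluster expansion"* (by reference to (2.13) [II] and [26]; cell GAPS
G-B16-09 — this is the FIRST exponentiation, whose reading stands; contrast the second one, G-B16-11). [cite: Balaban1989LargeFieldII, (1.97) p.390] -/
def Ineq197 (S : RelDomainSys) {Φ : Type*} (dom : S.Dom → Set Φ) (F : S.Dom → Φ → ℂ) (p0val α β κ : ℝ) : Prop :=
  (∀ X, ¬ S.MeetsLF X → ∀ φ ∈ dom X, ‖F X φ‖ ≤ Real.exp (-p0val) * Real.exp (-((1 + β) * κ) * S.dRel X)) ∧
  (∀ X, S.MeetsLF X → ∀ φ ∈ dom X, ‖F X φ‖ ≤ α ^ (1 / 3 : ℝ) * Real.exp (-((1 + β) * κ) * S.dRel X))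

/-- **(1.98)–(1.99)** p. 390 [36], verbatim (render p036): *"The estimate (1.97) is sufficient for convergence of the
exponentiated cluster expansion, and we have {…} = exp 𝐑′^{(k)} = exp Σ_X 𝐑′^{(k)}(X). (1.98) The summation here is over
domains X ∈ 𝐃_k, which have nonempty intersections with Z^c_k. In fact, admissible domains, i.e., domains with nonzero
expressions 𝐑′^{(k)}(X), have the intersections sufficiently large, because they contain at least one large field region
connected with one of the 𝐓′_k-operations. The expression 𝐑′^{(k)}(X) depends on the background field U_k restricted to
X, and it can be extended as an analytic function of the variables (𝐔,𝐉), defined on the space Ũ^c_k(X, α̃₀, α̃₁). It is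
given by the convergent series (7.13) [I] (with proper notational changes), and it satisfies the inequality
|𝐑′^{(k)}(X,(𝐔,𝐉))| ≤ O(1)c₁ exp(−(1+½β)κ d_{k,∪Y_i}(X)). (1.99)"* — no c₁-clause is printed after (1.99): `c₁` is that
of (1.97), selected by `X ∩ ⋃_i Y_i` (`S.MeetsLF`, see `RelDomainSys`); "Z^c_k" sic = the large-field region in [III]'s
complement notation (cell DIVERGENCE D-b02.8); "(7.13) [I]" = (2.13) of [II] (D-T1b).  The NAMING split follows (p. 390):
terms with X meeting `Z_k^~ ∪ ⋃_i Y_i^~` are the new boundary terms 𝐁′^{(k)}(X), the others the 𝐑-terms of the k-th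
step.  `C` = the O(1); `dom X` = `Ũ^c_k(X, α̃₀, α̃₁)`.  Decay RELATIVE to the erased components — NOT the printed (2.42)
[III] (`relDecay_not_fullDecay`; cell GAPS G-B16-10 (B)). [cite: Balaban1989LargeFieldII, (1.98)–(1.99) p.390] -/
def Ineq199 (S : RelDomainSys) {Φ : Type*} (dom : S.Dom → Set Φ) (R' : S.Dom → Φ → ℂ) (C p0val α β κ : ℝ) : Prop :=
  (∀ X, ¬ S.MeetsLF X → ∀ φ ∈ dom X,
      ‖R' X φ‖ ≤ C * Real.exp (-p0val) * Real.exp (-((1 + β / 2) * κ) * S.dRel X)) ∧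
  (∀ X, S.MeetsLF X → ∀ φ ∈ dom X,
      ‖R' X φ‖ ≤ C * α ^ (1 / 3 : ℝ) * Real.exp (-((1 + β / 2) * κ) * S.dRel X))

/-- **(1.100)** p. 390 [36], verbatim (render p036): *"The terms of the second group give the basic contribution to the
𝐑-terms in the kth renormalization step. By their definition the linear size of the domain X in (1.99) can be replaced by
d_k(X), and c₁ is equal to exp(−p₀(g_k)), hence we have the following more precise bound for them:
|𝐑′^{(k)}(X,(𝐔,𝐉))| ≤ exp(−p₀(g_k)) exp(−κ d_k(X)). (1.100) By their construction it is also clear that they are Euclidean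
covariant, i.e., they have the property (2.32) [III]."* (the O(1) and the extra `½βκ` of (1.99) absorbed; cell DIVERGENCE
D-b02.7 — typed as `ineq1100_of_199_floor` below, revision v12: the absorption `O(1)·exp(−½βκ d_k(X)) ≤ 1` holds as soon
as `d_k(X) ≥ d₀` on the domains concerned and `O(1) ≤ exp(½βκd₀)`; the print basis the cell offers for the floor — [IV]
p. 177 [3] *"We consider components of almost the minimal possible size. Each renormalization step adds at least ten
layers of MR_k-cubes, hence the size must be greater than 20 MR_k"* for the components of the large-field domain Z, of
which the first-class components X_j of p. 378 [24] (*"Thus, the components of Z are divided into two classes. For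
components of the first class, denoted by {X_1,…,X_n}, …"*) contained in every second-group domain are instances
(renders of both pages read as images; cell GAPS C-adv7-88 / C-adv7-89, cross-read C-b01g19-1) — is NOT adjudicated by this
module: the floor is a hypothesis).  Typed over the class `¬ S.MeetsLF X` = "X ∩ ⋃_i Y_i = ∅", which CONTAINS the printed "second group" (X disjoint
from `Z_k^~ ∪ ⋃_i Y_i^~`); for the extra domains (meeting only a collar or `Z_k^~`) the same bound is print's (1.99) with
`c₁ = exp(−p₀(g_k))` and (1.67) (`d_{k,∪Y_i}(X) = d_k(X)`), so nothing beyond print + D-b02.7 is asserted (D-b02.11).  The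
comparison with (2.31) [III] (`g_k^{κ₀}` in place of `exp(−p₀(g_k))`) is `boundR231_of_ineq1100`. [cite: Balaban1989LargeFieldII, (1.100) p.390] -/
def Ineq1100 (S : RelDomainSys) {Φ : Type*} (dom : S.Dom → Set Φ) (R' : S.Dom → Φ → ℂ) (p0val κ : ℝ) : Prop :=
  ∀ X, ¬ S.MeetsLF X → ∀ φ ∈ dom X, ‖R' X φ‖ ≤ Real.exp (-p0val) * Real.exp (-κ * S.dj X)

/-- Bookkeeping (1.99) ⇒ (1.100) with the constant kept: for X with `X ∩ ⋃_i Y_i = ∅` (`¬ S.MeetsLF X`) `d_{k,∪Y_i}(X) = d_k(X)`,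
so (1.99) gives `|𝐑′^{(k)}(X)| ≤ O(1)e^{−p₀(g_k)} e^{−(1+½β)κ d_k(X)} ≤ O(1)e^{−p₀(g_k)} e^{−κ d_k(X)}` for `β, κ ≥ 0` — i.e.
(1.100) up to the printed absorption of the O(1) (cell DIVERGENCE D-b02.7). [folklore] -/
theorem ineq1100_of_199 (S : RelDomainSys) {Φ : Type*} (dom : S.Dom → Set Φ) (R' : S.Dom → Φ → ℂ)
    (C p0val α β κ : ℝ) (hC : 0 ≤ C) (hβ : 0 ≤ β) (hκ : 0 ≤ κ) (h : Ineq199 S dom R' C p0val α β κ) :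
    ∀ X, ¬ S.MeetsLF X → ∀ φ ∈ dom X, ‖R' X φ‖ ≤ C * Real.exp (-p0val) * Real.exp (-κ * S.dj X) := by
  intro X hX φ hφ
  have h1 := h.1 X hX φ hφ
  rw [S.dRel_eq_of_not_meets X hX] at h1
  refine h1.trans (mul_le_mul_of_nonneg_left (Real.exp_le_exp.mpr ?_) (mul_nonneg hC (Real.exp_pos _).le))
  have hd : 0 ≤ S.dj X := S.dj_nonneg X
  nlinarith [mul_nonneg (mul_nonneg hβ hκ) hd]

/-- Bookkeeping (1.99) ⇒ (1.100) EXACTLY AS PRINTED (revision v12; cell DIVERGENCE D-b02.7's first alternative *"O(1)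
exp(−½βκd_k(X)) ≤ 1 for the (large) X concerned"* typed with the floor explicit): if every second-group domain has
`d_k(X) ≥ d₀` (`hfloor`) and the O(1) of (1.99) satisfies `C ≤ exp(½βκ·d₀)` (`habs`), then for `X ∩ ⋃_i Y_i = ∅`
`|𝐑′^{(k)}(X)| ≤ C e^{−p₀(g_k)} e^{−(1+½β)κ d_k(X)} = (C e^{−½βκ d_k(X)}) · e^{−p₀(g_k)} e^{−κ d_k(X)} ≤ e^{−p₀(g_k)} e^{−κ d_k(X)}`,
i.e. `Ineq1100` with no constant.  The floor itself ([IV] p. 177 *"the size must be greater than 20 MR_k"* for the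
components of Z ⊇ the first-class components X_j ⊆ X, p. 378; cell GAPS C-adv7-89) is a HYPOTHESIS, not adjudicated here;
with (1.99)'s O(1) = `e·ν·c₀·K₀²` of the sibling `B16Exp198.Geometry.ineq199_of_ineq197` the budget `habs` reads
`1 + log ν + log c₀ + 2 log K₀ ≤ ½βκ d₀` (cell SMALLNESS S-B16.17).  SCOPE (revision v13): `hfloor` is asked here of
EVERY second-group domain of the carrier; the print-scoped form (floor OR vanishing term — p. 390's "admissible
domains") is `ineq1100_of_199_adm` below, of which this theorem is the special case (`ineq1100_of_199_floor_of_adm`). [cite: Balaban1989LargeFieldII, (1.99)–(1.100) p.390] -/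
theorem ineq1100_of_199_floor (S : RelDomainSys) {Φ : Type*} (dom : S.Dom → Set Φ) (R' : S.Dom → Φ → ℂ)
    (C p0val α β κ d₀ : ℝ) (hβ : 0 ≤ β) (hκ : 0 ≤ κ)
    (hfloor : ∀ X, ¬ S.MeetsLF X → d₀ ≤ S.dj X) (habs : C ≤ Real.exp (β / 2 * κ * d₀))
    (h : Ineq199 S dom R' C p0val α β κ) : Ineq1100 S dom R' p0val κ := by
  intro X hX φ hφ
  have h1 := h.1 X hX φ hφ
  rw [S.dRel_eq_of_not_meets X hX] at h1
  have hd : d₀ ≤ S.dj X := hfloor X hX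
  have hsplit : C * Real.exp (-p0val) * Real.exp (-((1 + β / 2) * κ) * S.dj X)
      = (C * Real.exp (-(β / 2 * κ * S.dj X))) * (Real.exp (-p0val) * Real.exp (-κ * S.dj X)) := by
    have : Real.exp (-((1 + β / 2) * κ) * S.dj X) = Real.exp (-(β / 2 * κ * S.dj X)) * Real.exp (-κ * S.dj X) := by
      rw [← Real.exp_add]; congr 1; ring
    rw [this]; ring
  rw [hsplit] at h1
  have habs' : C * Real.exp (-(β / 2 * κ * S.dj X)) ≤ 1 := by
    have hle : C * Real.exp (-(β / 2 * κ * S.dj X)) ≤ Real.exp (β / 2 * κ * d₀) * Real.exp (-(β / 2 * κ * S.dj X)) :=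
      mul_le_mul_of_nonneg_right habs (Real.exp_pos _).le
    refine hle.trans ?_
    rw [← Real.exp_add, Real.exp_le_one_iff]
    nlinarith [mul_nonneg (mul_nonneg hβ hκ) (sub_nonneg.mpr hd)]
  calc ‖R' X φ‖ ≤ (C * Real.exp (-(β / 2 * κ * S.dj X))) * (Real.exp (-p0val) * Real.exp (-κ * S.dj X)) := h1
    _ ≤ 1 * (Real.exp (-p0val) * Real.exp (-κ * S.dj X)) :=
        mul_le_mul_of_nonneg_right habs' (mul_nonneg (Real.exp_pos _).le (Real.exp_pos _).le)
    _ = Real.exp (-p0val) * Real.exp (-κ * S.dj X) := one_mul _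

/-- Bookkeeping (1.99) ⇒ (1.100) with the floor SCOPED AS PRINTED (revision v13): p. 390 restricts the domains that
matter — *"The summation here is over domains X∈𝐃_k, which have nonempty intersections with Z^c_k. In fact, admissible
domains, i.e., domains with nonzero expressions 𝐑′^{(k)}(X), have the intersections sufficiently large, because they
contain at least one large field region connected with one of the 𝐓′_k-operations."* — so the floor `d₀ ≤ d_k(X)` is
asked only of the second-group domains whose term does NOT vanish: `hfloor : ∀ X, X ∩ ⋃Y_i = ∅ → (d₀ ≤ d_k(X) ∨
𝐑′^{(k)}(X) ≡ 0 on dom X)`.  The unrestricted floor of `ineq1100_of_199_floor` (v12) is the special case `Or.inl` (so that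
theorem follows from this one), but on a carrier `S.Dom = 𝐃_k` holding a non-meeting one-cube domain (`d_k = 0`) it is
unsatisfiable for `d₀ > 0`, whereas the scoped floor holds there as soon as that domain's term vanishes
(`ineq1100_floor_unsat_of_small`).  Pointed out, with a kernel-checked scratch proof against revision v12, by the
cross-read of cell GAPS C-b01g19-1 (item O4, unit b2b-balaban-b01 generation 19); adopted here by the one-writer.  The
floor and its print basis ([IV] p. 177, p. 378 here) remain HYPOTHESES, not adjudicated in this module. [cite: Balaban1989LargeFieldII, (1.98)–(1.100) p.390] -/
theorem ineq1100_of_199_adm (S : RelDomainSys) {Φ : Type*} (dom : S.Dom → Set Φ) (R' : S.Dom → Φ → ℂ)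
    (C p0val α β κ d₀ : ℝ) (hβ : 0 ≤ β) (hκ : 0 ≤ κ)
    (hfloor : ∀ X, ¬ S.MeetsLF X → d₀ ≤ S.dj X ∨ ∀ φ ∈ dom X, R' X φ = 0)
    (habs : C ≤ Real.exp (β / 2 * κ * d₀))
    (h : Ineq199 S dom R' C p0val α β κ) : Ineq1100 S dom R' p0val κ := by
  intro X hX φ hφ
  rcases hfloor X hX with hd | hzero
  · have h1 := h.1 X hX φ hφ
    rw [S.dRel_eq_of_not_meets X hX] at h1
    have hsplit : C * Real.exp (-p0val) * Real.exp (-((1 + β / 2) * κ) * S.dj X)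
        = (C * Real.exp (-(β / 2 * κ * S.dj X))) * (Real.exp (-p0val) * Real.exp (-κ * S.dj X)) := by
      have : Real.exp (-((1 + β / 2) * κ) * S.dj X) = Real.exp (-(β / 2 * κ * S.dj X)) * Real.exp (-κ * S.dj X) := by
        rw [← Real.exp_add]; congr 1; ring
      rw [this]; ring
    rw [hsplit] at h1
    have habs' : C * Real.exp (-(β / 2 * κ * S.dj X)) ≤ 1 := by
      have hle : C * Real.exp (-(β / 2 * κ * S.dj X)) ≤ Real.exp (β / 2 * κ * d₀) * Real.exp (-(β / 2 * κ * S.dj X)) :=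
        mul_le_mul_of_nonneg_right habs (Real.exp_pos _).le
      refine hle.trans ?_
      rw [← Real.exp_add, Real.exp_le_one_iff]
      nlinarith [mul_nonneg (mul_nonneg hβ hκ) (sub_nonneg.mpr hd)]
    calc ‖R' X φ‖ ≤ (C * Real.exp (-(β / 2 * κ * S.dj X))) * (Real.exp (-p0val) * Real.exp (-κ * S.dj X)) := h1
      _ ≤ 1 * (Real.exp (-p0val) * Real.exp (-κ * S.dj X)) :=
          mul_le_mul_of_nonneg_right habs' (mul_nonneg (Real.exp_pos _).le (Real.exp_pos _).le)
      _ = Real.exp (-p0val) * Real.exp (-κ * S.dj X) := one_mul _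
  · rw [hzero φ hφ, norm_zero]
    exact mul_nonneg (Real.exp_pos _).le (Real.exp_pos _).le

/-- The v12 theorem is the special case `Or.inl` of the scoped one (revision v13; recorded as a theorem so that the
implication is kernel-checked, the v12 statement and proof above staying untouched). [folklore] -/
theorem ineq1100_of_199_floor_of_adm (S : RelDomainSys) {Φ : Type*} (dom : S.Dom → Set Φ) (R' : S.Dom → Φ → ℂ)
    (C p0val α β κ d₀ : ℝ) (hβ : 0 ≤ β) (hκ : 0 ≤ κ)
    (hfloor : ∀ X, ¬ S.MeetsLF X → d₀ ≤ S.dj X) (habs : C ≤ Real.exp (β / 2 * κ * d₀))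
    (h : Ineq199 S dom R' C p0val α β κ) : Ineq1100 S dom R' p0val κ :=
  ineq1100_of_199_adm S dom R' C p0val α β κ d₀ hβ hκ (fun X hX => Or.inl (hfloor X hX)) habs h

/-- Scope of the floor hypothesis (revision v13, cell GAPS C-b01g19-1 O4): on a carrier with a second-group domain of
tree size below `d₀` (e.g. a single cube far from ⋃Y_i, `d_k = 0`, present in 𝐃_k) the UNRESTRICTED floor of
`ineq1100_of_199_floor` fails — it is a hypothesis on the carrier, satisfiable on the admissible-restricted carrier or in
the scoped form of `ineq1100_of_199_adm`. [folklore] -/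
theorem ineq1100_floor_unsat_of_small (S : RelDomainSys) (X₀ : S.Dom) (h0 : ¬ S.MeetsLF X₀) (d₀ : ℝ)
    (hd : S.dj X₀ < d₀) : ¬ (∀ X, ¬ S.MeetsLF X → d₀ ≤ S.dj X) :=
  fun hfloor => absurd (hfloor X₀ h0) (not_le.mpr hd)

/-! ### 1d. (1.100) against the inductive hypothesis (2.31) [III] at the newest scale (p. 390; cell GAPS G-B16-10 (R)) -/

/-- (1.100) ⇒ (2.31) [III] for one term: `|𝐑′^{(k)}(X)| ≤ e^{−p₀(g_k)} e^{−κ d_k(X)} ≤ g_k^{κ₀} e^{−κ d_k(X)}` as soon as `κ₀ ≤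
2A₀(log g_k⁻²)^{p₀−1}` — for FIXED `κ₀` ("κ₀ can be chosen arbitrarily large", [III] (2.31) p. 260) a smallness condition on
`g_k ≤ γ`, i.e. the order of constants "κ₀ before γ" (cell GAPS G-B16-07, R11); composes `Step.exp_neg_p0Profile_le_pow`. [cite: Balaban1989LargeFieldII, (1.100) p.390] -/
theorem boundR231_of_ineq1100 (A₀ g κ dX r : ℝ) (p₀ κ₀ : ℕ) (hp : 1 ≤ p₀) (hg : 0 < g) (hg1 : g < 1)
    (hκ₀ : (κ₀ : ℝ) ≤ 2 * A₀ * (Real.log (g ^ 2)⁻¹) ^ (p₀ - 1 : ℕ))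
    (h : r ≤ Real.exp (-(p0Profile A₀ p₀ g)) * Real.exp (-κ * dX)) :
    r ≤ g ^ κ₀ * Real.exp (-κ * dX) :=
  h.trans (mul_le_mul_of_nonneg_right (Step.exp_neg_p0Profile_le_pow A₀ g p₀ κ₀ hp hg hg1 hκ₀) (Real.exp_pos _).le)

/-- The same at tower level, producing EXACTLY the `boundR` clause of `Step.LFHypImproved T c βc k` (the improved bound
demanded of the newest 𝐑-terms, [III] p. 262, decay rate `(1+4βc)κ`) from a (1.99)/(1.100)-type bound with the small factor
`exp(−p₀(g_k))` (`p₀(g) = p0Profile c.A₀ c.p₀ g`) and the same rate, under `0 < g_k < 1` and `κ₀ ≤ 2A₀(log g_k⁻²)^{p₀−1}`.  On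
rates: [III] p. 262 says "(1+4β)κ, for example"; what (1.99) delivers for the new 𝐑-terms is `(1+½β)κ` (relative = full size
for these X), i.e. the clause holds with `βc = β/8` — the "for example" is load-bearing (cell GAPS G-B16-10).  This is the
only field of `Step.LFNewTerms` that §1 discharges by a displayed inequality; `localDepR`/`gaugeInvR` are "by their
construction" (p. 390), the boundary-term bound is (1.99) in RELATIVE form (`relDecay_not_fullDecay`), and Euclidean
covariance (2.32) [III] is asserted ("it is also clear", p. 390; cell GAPS G-r2.8, G-B16-10 (cov)). [cite: Balaban1989LargeFieldII, (1.100) p.390] -/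
theorem lfBoundR_new_of_ineq1100 {P : Params} {G : Type*} [GaugeGroup G] {Φ 𝒢 𝔄 : Type*}
    (T : Step.LFTower P G Φ 𝒢 𝔄) (c : Step.LFConsts) (βc : ℝ) (k : ℕ)
    (hp : 1 ≤ c.p₀) (hg : 0 < T.flow.g k) (hg1 : T.flow.g k < 1)
    (hκ₀ : (c.κ₀ : ℝ) ≤ 2 * c.A₀ * (Real.log ((T.flow.g k) ^ 2)⁻¹) ^ (c.p₀ - 1 : ℕ))
    (h1100 : ∀ X φ, φ ∈ T.space k X (c.alpha0 (T.flow.g k)) (c.alpha1 (T.flow.g k)) →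
      ‖T.R k X φ‖ ≤ Real.exp (-(p0Profile c.A₀ c.p₀ (T.flow.g k))) *
        Real.exp (-((1 + 4 * βc) * c.κ) * (T.sys k).dj X)) :
    1 ≤ k → ∀ X φ, φ ∈ T.space k X (c.alpha0 (T.flow.g k)) (c.alpha1 (T.flow.g k)) →
      ‖T.R k X φ‖ ≤ (T.flow.g k) ^ c.κ₀ * Real.exp (-((1 + 4 * βc) * c.κ) * (T.sys k).dj X) := by
  intro _ X φ hφ
  exact (h1100 X φ hφ).trans (mul_le_mul_of_nonneg_right
    (Step.exp_neg_p0Profile_le_pow c.A₀ (T.flow.g k) c.p₀ c.κ₀ hp hg hg1 hκ₀) (Real.exp_pos _).le)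

/-! ### 1e. The proof structure of Theorem 1 (induction on k), as the paper states it -/

/-- BASE of the induction on k: [III] Thm 1 p. 262 — *"ρ₀ = exp[−(1/g₀²)A − E]"* has the form (2.18) [III] with no 𝐄-, 𝐑-,
𝐁-terms (cf. `Step.LFHyp.zero`); for fixed `γ`, over all runs whose couplings lie in ]0, γ]. [cite: Balaban1988Convergent, Thm 1 p.262] -/
def InductionBase (C : Construction) (γ : ℝ) : Prop :=
  ∀ P : B12.RunParams, (C P).flow.InInterval γ P.K → (C P).Sect2Form 0

/-- STEP of the induction on k = what §1 of this paper (together with [IV] and §3 [III]) claims to deliver, p. 390–391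
[36–37], verbatim (renders p036/p037): *"This new action satisfies the induction hypothesis, as it follows from the
construction and the properties of the new terms. […] From (1.72), (1.98), and the above definitions, it follows that the
result 𝐑ρ_k of the 𝐑-operation can be written in the form (2.18) [III], with all the expressions satisfying the induction
hypothesis described in Sect. 2 [III]. This completes the proof of Theorem 1 and Corollary 3."* — for runs with couplings
in ]0, γ]: `Sect2Form k → Sect2Form (k+1)` for `k < K`.  The cell's clause-by-clause audit of this sentence is GAPS G-r2.8 /
G-B16-10 (what is delivered: (1.99), (1.100), (1.102); what is asserted: (2.32), "all the properties"). [cite: Balaban1989LargeFieldII, p.390–391] -/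
def InductionStep (C : Construction) (γ : ℝ) : Prop :=
  ∀ P : B12.RunParams, (C P).flow.InInterval γ P.K → ∀ k, k < P.K → (C P).Sect2Form k → (C P).Sect2Form (k + 1)

/-- **Theorem 1 ⇐ base + step**, the proof structure exactly as printed ([III] Thm 1 p. 262 + p. 391 here: *"This
completes the proof of Theorem 1 and Corollary 3."*): induction on `k ≤ K` for each run.  Pure bookkeeping; the content
is in `InductionStep`. [cite: Balaban1989LargeFieldII, Thm 1 p.355 + p.391] -/
theorem thm1_of_steps (C : Construction) (γ : ℝ) (hγ : 0 < γ) (h0 : InductionBase C γ) (hs : InductionStep C γ) :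
    Thm1Printed C := by
  refine ⟨γ, hγ, fun P hP k hk => ?_⟩
  induction k with
  | zero => exact h0 P hP
  | succ n ih => exact hs P hP n (by omega) (ih (by omega))

/-- Converse bookkeeping: Theorem 1 trivially contains the step (so `InductionStep` is not a stronger claim than the
theorem — it is its printed proof shape). [folklore] -/
theorem inductionStep_of_thm1With (C : Construction) (γ : ℝ)
    (h : ∀ P : B12.RunParams, (C P).flow.InInterval γ P.K → ∀ k, k ≤ P.K → (C P).Sect2Form k) :
    InductionBase C γ ∧ InductionStep C γ :=
  ⟨fun P hP => h P hP 0 (Nat.zero_le _), fun P hP k hk _ => h P hP (k + 1) (by omega)⟩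

/-! ### 1f. (0.1) from [III] Cor. 3: the missing uniformity clause, in its natural printed-constants form (cell GAPS G-B16-08 (d)) -/

/-- If the dependence functions `e_±(g_k)` of [III] Cor. 3 extend CONTINUOUSLY to the closed interval `[0, γ]`, then they
are bounded on ]0, γ] and (0.1) holds in the run-uniform reading `UVBound01` (`E_±` independent of k AND of the coupling).
Compactness of `[0, γ]` + `uvBound01_of_cor3_bounded`; no analytic content.  STATUS OF THE HYPOTHESIS (revision v5; cell
GAPS G-B16-07/08 (d), G-pv24-1): an earlier revision of this docstring said every constant produced in §1 so extends
("each is a fixed function of `d, L, M, A₀, A₁, B₃, B₅, γ₀, p₀, p₁, r₀, β, β₀, κ` times factors tending to 0 with `g_k`");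
that covers the §1 constants and the LARGE-field logarithms of (2.49) [III], not the vacuum-energy counterterm E_k entering
e₊: UNDER THE CELL'S TYPED COUNT of the printed normalisation ρ₀ = exp[−(1/g₀²)A − E] ([III] Thm 1 p. 262, E from (1.15)
p. 249 and p. 254) — `B16B10Shape.LogNormalised`, whose reader's leaves are `ZLower` (proved for U(N), SU(N) in `B16ZLower`),
the bond count `TstarCount` (proved in dictionary form in `B16TstarCount`, revision v9) and `EflBound` (open: author question
(ii) of cell GAPS G-pv24-1, put to the author) — `e₊(g₀) ≥ c·log g₀⁻¹ − C₀` (`B16B10Shape.ep_unbounded_of_cor3`), so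
that under those hypotheses `ContinuousOn ep (Set.Icc 0 γ)` is not dischargeable once small bare couplings occur (a
conditional kernel result about a reading, not a printed statement: revision v6, cell GAPS G-ref2-11 (a); revision v10: the
`LogNormalised` hypothesis carries a K = 0 cut — see `endStatementB_of_printed_bounded` — and small bare couplings on runs
with K ≥ 1 are supplied by forward generation + the printed upper β-bound + non-empty lattices, `B16SmallCouplings` §3 —
revision v11, XREAD C-pv12g8-1 A3; the leaf family is instantiated for G = SU(N) in `B16LeafFamily`, see the module
docstring).  The usable
statement is the half-open one,
`B16B10Shape.uvCompact_of_cor3_continuousOn_Ioc` (continuity on ]0, γ] ⇒ the compact-window reading `UVBound01Compact`).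
The p. 356 clause ("independent of k, T_η, U_k") is silent on the coupling, and the body of the paper argues no
uniformity in it (the proof ends p. 391 with "This completes the proof of Theorem 1 and Corollary 3"). [folklore] -/
theorem uvBound01_of_cor3_continuousOn (C : Construction) (hsign : SignConventions C)
    (h : ∃ γ : ℝ, 0 < γ ∧ ∃ em ep : ℝ → ℝ, Cor3With C γ em ep ∧
      ContinuousOn em (Set.Icc 0 γ) ∧ ContinuousOn ep (Set.Icc 0 γ)) :
    UVBound01 C := by
  obtain ⟨γ, hγ, em, ep, hcor, hem, hep⟩ := h
  obtain ⟨Em, hEm⟩ := isCompact_Icc.bddAbove_image hem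
  obtain ⟨Ep, hEp⟩ := isCompact_Icc.bddAbove_image hep
  refine uvBound01_of_cor3_bounded C hsign
    ⟨γ, hγ, em, ep, hcor, ⟨Em, fun x hx hxγ => ?_⟩, ⟨Ep, fun x hx hxγ => ?_⟩⟩
  · exact hEm ⟨x, ⟨hx.le, hxγ⟩, rfl⟩
  · exact hEp ⟨x, ⟨hx.le, hxγ⟩, rfl⟩


/-! ## Promised continuations recorded in the paper (verbatim; none is a node of the series)

p. 356 [2]: *"Theorem 1 is the basis for many other applications, for example, for an analysis of expectation values
of physical observables, like loop variables, averaged loop variables, etc. These problems are very important for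
construction of the four-dimensional gauge field theories, and they deserve detailed analysis and further
publication. Another important direction for future development is to include interactions with matter fields, e.g.
Fermi fields in quantum chromodynamics."* — NO statement about any observable, continuum limit of expectations, or
infinite volume is asserted in B10–B16; deliberately NOT given a `Prop` here: it is not a node of the series. -/

end Literature.MathematicalPhysics.QuantumFieldTheory.Balaban1983to89.B16
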